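import Mathlib
import Literature.Computability.AlgebraicComplexity.BirkhoffShadow
import HarnessLib

/-!
# Proof of the lower half of Hrubeš–Yehudayoff 2021, Prop. 23: `σ(DS_n) ≥ 2^{Ω(log² n)}`

Topic `Literature/Computability/AlgebraicComplexity`; companion proof file of `BirkhoffShadow.lean`,
whose named fact `HrubesYehudayoff2021_prop23_lower` (the shadow complexity of the Birkhoff polytope
is at least quasi-polynomial) is DISCHARGED here:
`theorem HrubesYehudayoff2021_prop23_lower_holds : HrubesYehudayoff2021_prop23_lower`
(with the explicit constants `c = 1/100`, `n₀ = 1024`).  (The upper half,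
`HrubesYehudayoff2021_prop23_upper_holds`, lives in the sibling `BirkhoffShadowProofs.lean`; the
two proofs share nothing, whence the separate file.)

## Source and proof followed

Hrubeš–Yehudayoff prove Prop. 23 (lower half) in one sentence: "As pointed by Mulmuley and Shah
in [37], the lower bound for `CONN_n` translates to `DS_n`" — i.e. Carstensen's theorem that the
parametric shortest-path cost in an `n`-vertex graph with edge weights `a_e + λ b_e` can have
`n^{Ω(log n)} = 2^{Ω(log² n)}` break points [Carstensen 1983; simplified by Mulmuley–Shah 2001,
Thm 1.2 / Lemma 4.1], transported to the Birkhoff polytope along the standard embedding of `s–t`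
paths of a DAG into perfect matchings / permutation matrices.  We formalise exactly this:

* **Sections A–D** (`BirkhoffShadowLower.*`): the Carstensen–Mulmuley–Shah construction in the
  cleaned-up form of Gajjar–Radhakrishnan [GajjarRadhakrishnan2019, §4, Lemma 26 = "essentially
  Lemma 4.1 of Mulmuley & Shah", read from the full version ECCC TR18-211 rev. 1, pp. 13–24], in
  its NON-planar version (the linking gadget `L(B, n)` of their §3.1 is used directly; no
  planarization, no bit-length bookkeeping).  Layered graphs are lists of layers on row set `ℕ`
  (`Layer`, `IsWalk`, `cost`, `mirror`); `graph n m B D` is their `G(B, D, m)` with the constants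
  (27)–(30) (`KR`, `KL`, `DL`), `path n m b j` their dedicated walk `P_{bj}` (33), `alpha` their
  interval scheme §4.1 (with `N = n²`).  The six properties of the predicate `Φ(B, D, m)` become:
  (i) `length_graph`/`adj_bound` (size), (iii) `main_ineq` (the dedicated walk is the unique
  cheapest walk on its interval, by a margin `≥ 1`; Claims 34–35), (iv) `cost_path_shift`,
  (v) `endpt_path_injective` (only the endpoint-injectivity consequence of vertex-disjointness is
  needed), (vi) `path_injective`; (ii) (bit lengths) is not needed over `ℝ`.
* **Section E**: a point of `S` that is the strict unique maximiser of a linear functional is an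
  extreme point of `conv S` [folklore]; counting.
* **Section F**: the embedding of layered-DAG walks into permutation matrices of `Fin ν`
  (vertex `(i, x) ↦ 1 + iW + x`, extra vertex `s = 0`; a permutation inside the pattern
  {start arc, graph arcs, loops, return arcs} is one cycle through `s`, i.e. a walk, and the linear
  map `Lmap` reads off its cost; permutations leaving the pattern are penalised) — the
  "translation to `DS_n`" of Mulmuley–Shah [MulmuleyShah2001, Cor. 1.1] / HY21.
* **Section G**: `core` (for `B = 1`, `D = 0` the `n^m` dedicated walks give `n^m` vertices of a
  shadow of `DS_ν`) and the asymptotics `m = ⌊log₂ ν⌋/5`, `n = 2^m`, size `≤ 2^{4m} < ν`,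
  count `2^{m²} ≥ 2^{(log₂ ν)²/100}`.

## References

* P. Hrubeš, A. Yehudayoff, *Shadows of Newton polytopes*, CCC 2021, LIPIcs 200:9, Prop. 23
  [HrubesYehudayoff2021].
* K. Gajjar, J. Radhakrishnan, *Parametric shortest paths in planar graphs*, FOCS 2019, 876–895;
  full version ECCC TR18-211 rev. 1 (2019), §3.1, §4 (Lemma 26, Claims 34–35), Thm 1
  [GajjarRadhakrishnan2019].
* K. Mulmuley, P. Shah, *A lower bound for the shortest path problem*, JCSS 63 (2001) 253–267,
  Thm 1.2, Lemma 4.1, Cor. 1.1 [MulmuleyShah2001].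
* P. Carstensen, *The complexity of some problems in parametric linear and combinatorial
  programming*, PhD thesis, Univ. of Michigan (1983) [cited through the above].
-/

noncomputable section

namespace Literature.Computability.AlgebraicComplexity

namespace BirkhoffShadowLower

/-- Value at parameter `t` of the affine cost `c = (constant, slope)`: `c.1 + t * c.2`.
[folklore] -/
def eval (c : ℝ × ℝ) (t : ℝ) : ℝ := c.1 + t * c.2

/-- `eval` is additive in the cost pair. [folklore] -/
@[simp] theorem eval_add (c c' : ℝ × ℝ) (t : ℝ) : eval (c + c') t = eval c t + eval c' t := by
  simp only [eval, Prod.fst_add, Prod.snd_add]; ring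

/-- The zero cost evaluates to `0`. [folklore] -/
@[simp] theorem eval_zero (t : ℝ) : eval 0 t = 0 := by simp [eval]

/-- One layer of arcs of a layered graph on row set `ℕ`: an adjacency relation between the rows of
two consecutive columns and an affine weight `(constant, slope)` on each pair of rows. [folklore] -/
structure Layer where
  adj : ℕ → ℕ → Prop
  w : ℕ → ℕ → ℝ × ℝ

/-- The reversed layer. [folklore] -/
def Layer.flip (l : Layer) : Layer := ⟨fun x y => l.adj y x, fun x y => l.w y x⟩

/-- Reversing a layer twice gives it back. [folklore] -/
@[simp] theorem Layer.flip_flip (l : Layer) : l.flip.flip = l := by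
  cases l; rfl

/-- Scale all weights by `K` and substitute `t ↦ t / N` in the parameter. [folklore] -/
def Layer.smap (K N : ℝ) (l : Layer) : Layer :=
  ⟨l.adj, fun x y => (K * (l.w x y).1, K * (l.w x y).2 / N)⟩

/-- Rescaling weights does not change the arcs. [folklore] -/
@[simp] theorem Layer.smap_adj (K N : ℝ) (l : Layer) : (l.smap K N).adj = l.adj := rfl

/-- Reversal commutes with rescaling. [folklore] -/
theorem Layer.flip_smap (K N : ℝ) (l : Layer) : (l.smap K N).flip = l.flip.smap K N := rfl

/-- `IsWalk G b p`: starting from row `b` in column `0`, the list `p` of subsequent rows is a walk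
through all the layers of `G` (one row per layer). [folklore] -/
def IsWalk : List Layer → ℕ → List ℕ → Prop
  | [], _, [] => True
  | [], _, _ :: _ => False
  | _ :: _, _, [] => False
  | l :: G, b, r :: rs => l.adj b r ∧ IsWalk G r rs

/-- Total affine cost of the row sequence `p` started at `b` (weights summed layer by layer).
[folklore] -/
def cost : List Layer → ℕ → List ℕ → ℝ × ℝ
  | l :: G, b, r :: rs => l.w b r + cost G r rs
  | _, _, _ => 0

/-- Last row of the row sequence `p` started at `b`. [folklore] -/
def endpt : ℕ → List ℕ → ℕ
  | b, [] => b
  | _, r :: rs => endpt r rs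

/-- The empty row sequence is a walk through the empty graph. [folklore] -/
@[simp] theorem isWalk_nil_nil (b : ℕ) : IsWalk [] b [] := trivial
/-- A nonempty row sequence is not a walk through the empty graph. [folklore] -/
@[simp] theorem isWalk_nil_cons (b r : ℕ) (rs : List ℕ) : ¬ IsWalk [] b (r :: rs) := id
/-- The empty row sequence is not a walk through a nonempty graph. [folklore] -/
@[simp] theorem isWalk_cons_nil (l : Layer) (G : List Layer) (b : ℕ) : ¬ IsWalk (l :: G) b [] := id
/-- Unfolding `IsWalk` one layer. [folklore] -/
@[simp] theorem isWalk_cons_cons (l : Layer) (G : List Layer) (b r : ℕ) (rs : List ℕ) :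
    IsWalk (l :: G) b (r :: rs) ↔ l.adj b r ∧ IsWalk G r rs := Iff.rfl
/-- Unfolding `cost` one layer. [folklore] -/
@[simp] theorem cost_cons_cons (l : Layer) (G : List Layer) (b r : ℕ) (rs : List ℕ) :
    cost (l :: G) b (r :: rs) = l.w b r + cost G r rs := rfl
/-- Cost through the empty graph is `0`. [folklore] -/
@[simp] theorem cost_nil (b : ℕ) (p : List ℕ) : cost [] b p = 0 := by cases p <;> rfl
/-- Cost of the empty row sequence is `0`. [folklore] -/
@[simp] theorem cost_cons_nil (l : Layer) (G : List Layer) (b : ℕ) : cost (l :: G) b [] = 0 := rfl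
/-- Endpoint of the empty row sequence. [folklore] -/
@[simp] theorem endpt_nil (b : ℕ) : endpt b [] = b := rfl
/-- Endpoint after the first step. [folklore] -/
@[simp] theorem endpt_cons (b r : ℕ) (rs : List ℕ) : endpt b (r :: rs) = endpt r rs := rfl

/-- Walks through the empty graph are empty. [folklore] -/
theorem isWalk_nil_iff (b : ℕ) (p : List ℕ) : IsWalk [] b p ↔ p = [] := by
  cases p <;> simp

/-- A walk has one row per layer. [folklore] -/
theorem IsWalk.length_eq : ∀ {G : List Layer} {b : ℕ} {p : List ℕ}, IsWalk G b p → p.length = G.length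
  | [], _, [], _ => rfl
  | [], _, _ :: _, h => h.elim
  | _ :: _, _, [], h => h.elim
  | _ :: G, _, r :: rs, h => by
    simp only [List.length_cons, Nat.add_right_cancel_iff]
    exact IsWalk.length_eq (G := G) (b := r) (p := rs) h.2

/-- Endpoint of a concatenation. [folklore] -/
theorem endpt_append (b : ℕ) (p q : List ℕ) : endpt b (p ++ q) = endpt (endpt b p) q := by
  induction p generalizing b with
  | nil => rfl
  | cons r rs ih => exact ih r

/-- Walks through a concatenation of graphs are concatenations of walks. [folklore] -/
theorem isWalk_append {G₁ G₂ : List Layer} {b : ℕ} {p₁ p₂ : List ℕ} (h : p₁.length = G₁.length) :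
    IsWalk (G₁ ++ G₂) b (p₁ ++ p₂) ↔ IsWalk G₁ b p₁ ∧ IsWalk G₂ (endpt b p₁) p₂ := by
  induction G₁ generalizing b p₁ with
  | nil =>
    cases p₁ with
    | nil => simp
    | cons _ _ => simp at h
  | cons l G ih =>
    cases p₁ with
    | nil => simp at h
    | cons r rs =>
      simp only [List.length_cons, Nat.add_right_cancel_iff] at h
      simp only [List.cons_append, isWalk_cons_cons, endpt_cons, ih h, and_assoc]

/-- Cost is additive under concatenation. [folklore] -/
theorem cost_append {G₁ G₂ : List Layer} {b : ℕ} {p₁ p₂ : List ℕ} (h : p₁.length = G₁.length) :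
    cost (G₁ ++ G₂) b (p₁ ++ p₂) = cost G₁ b p₁ + cost G₂ (endpt b p₁) p₂ := by
  induction G₁ generalizing b p₁ with
  | nil =>
    cases p₁ with
    | nil => simp
    | cons _ _ => simp at h
  | cons l G ih =>
    cases p₁ with
    | nil => simp at h
    | cons r rs =>
      simp only [List.length_cons, Nat.add_right_cancel_iff] at h
      simp only [List.cons_append, cost_cons_cons, endpt_cons, ih h, add_assoc]

/-- A walk through `G₁ ++ G₂` splits into a walk through `G₁` followed by one through `G₂`.
[folklore] -/
theorem isWalk_append_split {G₁ G₂ : List Layer} {b : ℕ} {p : List ℕ}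
    (h : IsWalk (G₁ ++ G₂) b p) :
    ∃ p₁ p₂, p = p₁ ++ p₂ ∧ p₁.length = G₁.length ∧ IsWalk G₁ b p₁ ∧
      IsWalk G₂ (endpt b p₁) p₂ := by
  have hlen := h.length_eq
  refine ⟨p.take G₁.length, p.drop G₁.length, (List.take_append_drop _ _).symm, ?_, ?_⟩
  · rw [List.length_take, hlen, List.length_append]
    omega
  · have h1 : (p.take G₁.length).length = G₁.length := by
      rw [List.length_take, hlen, List.length_append]; omega
    rw [← List.take_append_drop G₁.length p] at h
    exact (isWalk_append h1).1 h

/-! ### Weight maps -/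

/-- Rescaling weights does not change walks. [folklore] -/
theorem isWalk_map_smap (K N : ℝ) :
    ∀ (G : List Layer) (b : ℕ) (p : List ℕ), IsWalk (G.map (Layer.smap K N)) b p ↔ IsWalk G b p
  | [], b, p => by simp
  | l :: G, b, [] => by simp
  | l :: G, b, r :: rs => by
    simp only [List.map_cons, isWalk_cons_cons, Layer.smap_adj, isWalk_map_smap K N G r rs]

/-- Cost after rescaling by `K` and substituting `t ↦ t/N`. [folklore] -/
theorem cost_map_smap (K N : ℝ) :
    ∀ (G : List Layer) (b : ℕ) (p : List ℕ),
      cost (G.map (Layer.smap K N)) b p = (K * (cost G b p).1, K * (cost G b p).2 / N)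
  | [], b, p => by simp [Prod.ext_iff]
  | l :: G, b, [] => by simp [Prod.ext_iff]
  | l :: G, b, r :: rs => by
    simp only [List.map_cons, cost_cons_cons, cost_map_smap K N G r rs, Layer.smap, Prod.mk_add_mk,
      Prod.fst_add, Prod.snd_add]
    ext <;> ring

/-- Evaluating a rescaled cost: `K · c(t/N)`. [folklore] -/
theorem eval_smap (K N : ℝ) (hN : N ≠ 0) (c : ℝ × ℝ) (t : ℝ) :
    eval (K * c.1, K * c.2 / N) t = K * eval c (t / N) := by
  simp only [eval]; field_simp

/-! ### Mirror -/

/-- The mirror image of a layered graph: layers in reverse order, each reversed. [folklore] -/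
def mirror (G : List Layer) : List Layer := (G.map Layer.flip).reverse

/-- The mirrored row sequence: the walk `b, p` read backwards (without its new starting row).
[folklore] -/
def mirrorPath (b : ℕ) (p : List ℕ) : List ℕ := ((b :: p).reverse).tail

/-- Mirror of the empty graph. [folklore] -/
@[simp] theorem mirror_nil : mirror [] = [] := rfl

/-- Mirror of a graph with a first layer. [folklore] -/
theorem mirror_cons (l : Layer) (G : List Layer) : mirror (l :: G) = mirror G ++ [l.flip] := by
  simp [mirror]

/-- Mirroring is an involution. [folklore] -/
@[simp] theorem mirror_mirror (G : List Layer) : mirror (mirror G) = G := by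
  simp [mirror, List.map_reverse, Function.comp_def]

/-- Mirroring preserves the number of layers. [folklore] -/
@[simp] theorem length_mirror (G : List Layer) : (mirror G).length = G.length := by
  simp [mirror]

/-- Mirroring commutes with rescaling. [folklore] -/
theorem mirror_map_smap (K N : ℝ) (G : List Layer) :
    mirror (G.map (Layer.smap K N)) = (mirror G).map (Layer.smap K N) := by
  simp [mirror, List.map_reverse, Function.comp_def, Layer.flip_smap]

/-- Layers of the mirror image. [folklore] -/
theorem mem_mirror {l : Layer} {G : List Layer} : l ∈ mirror G ↔ l.flip ∈ G := by
  constructor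
  · intro h
    simp only [mirror, List.mem_reverse, List.mem_map] at h
    obtain ⟨l', hl', rfl⟩ := h
    simpa using hl'
  · intro h
    simp only [mirror, List.mem_reverse, List.mem_map]
    exact ⟨l.flip, h, by simp⟩

/-- Mirror of the empty row sequence. [folklore] -/
@[simp] theorem mirrorPath_nil (b : ℕ) : mirrorPath b [] = [] := rfl

/-- Reading a walk backwards: its old endpoint first, then `mirrorPath`. [folklore] -/
theorem reverse_cons_eq (b : ℕ) (p : List ℕ) :
    (b :: p).reverse = endpt b p :: mirrorPath b p := by
  induction p generalizing b with
  | nil => rfl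
  | cons r rs ih =>
    have h1 : (b :: r :: rs).reverse = (r :: rs).reverse ++ [b] := List.reverse_cons
    rw [mirrorPath, h1, ih r]
    rfl

/-- Unfolding `mirrorPath` one step. [folklore] -/
theorem mirrorPath_cons (b r : ℕ) (rs : List ℕ) :
    mirrorPath b (r :: rs) = mirrorPath r rs ++ [b] := by
  have h1 : (b :: r :: rs).reverse = (r :: rs).reverse ++ [b] := List.reverse_cons
  rw [mirrorPath, h1, reverse_cons_eq r rs]
  rfl

/-- `mirrorPath` preserves length. [folklore] -/
@[simp] theorem length_mirrorPath (b : ℕ) (p : List ℕ) : (mirrorPath b p).length = p.length := by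
  have h := congrArg List.length (reverse_cons_eq b p)
  simp only [List.length_reverse, List.length_cons] at h
  omega

/-- `mirrorPath` is an involution (with the right starting rows). [folklore] -/
theorem mirrorPath_mirrorPath (b : ℕ) (p : List ℕ) :
    mirrorPath (endpt b p) (mirrorPath b p) = p := by
  have h := reverse_cons_eq b p
  have h2 : (endpt b p :: mirrorPath b p).reverse = b :: p := by
    rw [← h, List.reverse_reverse]
  rw [mirrorPath, h2]
  rfl

/-- The mirrored row sequence ends at the old starting row. [folklore] -/
theorem endpt_mirrorPath (b : ℕ) (p : List ℕ) : endpt (endpt b p) (mirrorPath b p) = b := by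
  have h := reverse_cons_eq (endpt b p) (mirrorPath b p)
  rw [mirrorPath_mirrorPath] at h
  have h2 : (endpt b p :: mirrorPath b p).reverse = b :: p := by
    rw [← reverse_cons_eq b p, List.reverse_reverse]
  rw [h2] at h
  exact (List.cons.inj h).1.symm

/-- Costs in the mirror image: reading a row sequence backwards through `mirror G` costs the same.
[folklore] -/
theorem cost_mirror :
    ∀ {G : List Layer} {b : ℕ} {p : List ℕ}, p.length = G.length →
      cost (mirror G) (endpt b p) (mirrorPath b p) = cost G b p
  | [], b, [], _ => by simp
  | [], _, _ :: _, h => by simp at h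
  | _ :: _, _, [], h => by simp at h
  | l :: G, b, r :: rs, h => by
    simp only [List.length_cons, Nat.add_right_cancel_iff] at h
    have ih := cost_mirror (G := G) (b := r) (p := rs) h
    have hlen : (mirrorPath r rs).length = (mirror G).length := by
      rw [length_mirrorPath, length_mirror, h]
    rw [mirror_cons, endpt_cons, mirrorPath_cons, cost_append hlen, ih, endpt_mirrorPath,
      cost_cons_cons]
    simp only [cost_cons_cons, cost_nil, add_zero, Layer.flip]
    rw [add_comm]

/-- Walks in the mirror image: reading a walk backwards gives a walk through `mirror G` from the
old endpoint back to the old starting row. [folklore] -/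
theorem isWalk_mirror :
    ∀ {G : List Layer} {b : ℕ} {p : List ℕ}, IsWalk G b p →
      IsWalk (mirror G) (endpt b p) (mirrorPath b p)
  | [], b, [], _ => by simp
  | [], _, _ :: _, h => h.elim
  | _ :: _, _, [], h => h.elim
  | l :: G, b, r :: rs, h => by
    obtain ⟨hadj, hrs⟩ := h
    have ih := isWalk_mirror hrs
    have hlen : (mirrorPath r rs).length = (mirror G).length := by
      rw [length_mirrorPath, length_mirror, hrs.length_eq]
    rw [mirror_cons, endpt_cons, mirrorPath_cons]
    refine (isWalk_append hlen).2 ⟨ih, ?_⟩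
    rw [endpt_mirrorPath]
    exact ⟨hadj, trivial⟩

/-- Converse reading: a walk `q` through `mirror G` from `x` is the mirror image of the walk
`mirrorPath x q` through `G` from the endpoint of `q`, which ends at `x` and has the same cost.
[folklore] -/
theorem isWalk_of_mirror {G : List Layer} {x : ℕ} {q : List ℕ} (h : IsWalk (mirror G) x q) :
    IsWalk G (endpt x q) (mirrorPath x q) ∧ endpt (endpt x q) (mirrorPath x q) = x ∧
      cost G (endpt x q) (mirrorPath x q) = cost (mirror G) x q := by
  have h1 := isWalk_mirror h
  have h2 := cost_mirror (b := x) (h.length_eq)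
  rw [mirror_mirror] at h1 h2
  exact ⟨h1, endpt_mirrorPath x q, h2⟩

/-! ### Section B: the interval scheme `α(m, j)` (GR19 §4.1)

`alpha n m j` is the left end of the `j`-th parameter interval at recursion depth `m`
(`N = n²`, `α(0, 0) = 0`, `α(m+1, n·d + r) = N·α(m, d) + N·(r + 1)`); the interval itself is
`I(j, m) = [α + 1, α + N − 1]`. -/

/-- Left ends of the parameter intervals (GR19 §4.1, with `N = n²`).
[cite: GajjarRadhakrishnan2019, §4.1] -/
def alpha (n : ℕ) : ℕ → ℕ → ℕ
  | 0, _ => 0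
  | m + 1, j => n ^ 2 * alpha n m (j / n) + n ^ 2 * (j % n + 1)

/-- `α(0, j) = 0`. [cite: GajjarRadhakrishnan2019, §4.1] -/
@[simp] theorem alpha_zero (n j : ℕ) : alpha n 0 j = 0 := rfl

/-- The recursion for `α(m+1, j)`. [cite: GajjarRadhakrishnan2019, §4.1] -/
theorem alpha_succ (n m j : ℕ) :
    alpha n (m + 1) j = n ^ 2 * alpha n m (j / n) + n ^ 2 * (j % n + 1) := rfl

/-- `α(m, j) + N ≤ N^{m+1}` (GR19 §4.1, observation 4). [cite: GajjarRadhakrishnan2019, §4.1] -/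
theorem alpha_bound {n : ℕ} (hn : 2 ≤ n) : ∀ m j, alpha n m j + n ^ 2 ≤ (n ^ 2) ^ (m + 1)
  | 0, j => by simp
  | m + 1, j => by
    have ih := alpha_bound hn m (j / n)
    have hr : j % n < n := Nat.mod_lt _ (by omega)
    have hr2 : j % n + 2 ≤ n ^ 2 := by nlinarith
    have h1 := Nat.mul_le_mul_left (n ^ 2) ih
    rw [alpha_succ, pow_succ (n ^ 2) (m + 1)]
    nlinarith [h1, hr2]

/-- `α(m, j) + N ≤ N^{m+1}` over `ℝ`. [cite: GajjarRadhakrishnan2019, §4.1] -/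
theorem alpha_bound_real {n : ℕ} (hn : 2 ≤ n) (m j : ℕ) :
    (alpha n m j : ℝ) + (n : ℝ) ^ 2 ≤ ((n : ℝ) ^ 2) ^ (m + 1) := by
  exact_mod_cast alpha_bound hn m j

/-- Nesting of the intervals: if `t ∈ I(j, m+1)` then `t / N` lies in `I(j / n, m)`, at position
`r + 1 + [1/N, 1 − 1/N]` past its left end, where `r = j % n`.
[cite: GajjarRadhakrishnan2019, §4.1] -/
theorem interval_nesting {n : ℕ} (hn : 2 ≤ n) {m j : ℕ} {t : ℝ}
    (ht1 : (alpha n (m + 1) j : ℝ) + 1 ≤ t) (ht2 : t ≤ (alpha n (m + 1) j : ℝ) + (n : ℝ) ^ 2 - 1) :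
    (alpha n m (j / n) : ℝ) + (((j % n : ℕ) : ℝ) + 1) + 1 / (n : ℝ) ^ 2 ≤ t / (n : ℝ) ^ 2 ∧
      t / (n : ℝ) ^ 2 ≤ (alpha n m (j / n) : ℝ) + (((j % n : ℕ) : ℝ) + 1) + 1 - 1 / (n : ℝ) ^ 2 := by
  have hN : (0 : ℝ) < (n : ℝ) ^ 2 := by positivity
  rw [alpha_succ] at ht1 ht2
  push_cast at ht1 ht2
  have hNne : ((n : ℝ) ^ 2) ≠ 0 := hN.ne'
  constructor
  · have : ((alpha n m (j / n) : ℝ) + (((j % n : ℕ) : ℝ) + 1) + 1 / (n : ℝ) ^ 2) * (n : ℝ) ^ 2 ≤ t := by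
      field_simp
      linarith
    calc (alpha n m (j / n) : ℝ) + (((j % n : ℕ) : ℝ) + 1) + 1 / (n : ℝ) ^ 2
        = ((alpha n m (j / n) : ℝ) + (((j % n : ℕ) : ℝ) + 1) + 1 / (n : ℝ) ^ 2) * (n : ℝ) ^ 2 / (n : ℝ) ^ 2 := by
          field_simp
      _ ≤ t / (n : ℝ) ^ 2 := by gcongr
  · have : t ≤ ((alpha n m (j / n) : ℝ) + (((j % n : ℕ) : ℝ) + 1) + 1 - 1 / (n : ℝ) ^ 2) * (n : ℝ) ^ 2 := by
      field_simp
      linarith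
    calc t / (n : ℝ) ^ 2
        ≤ ((alpha n m (j / n) : ℝ) + (((j % n : ℕ) : ℝ) + 1) + 1 - 1 / (n : ℝ) ^ 2) * (n : ℝ) ^ 2 / (n : ℝ) ^ 2 := by
          gcongr
      _ = (alpha n m (j / n) : ℝ) + (((j % n : ℕ) : ℝ) + 1) + 1 - 1 / (n : ℝ) ^ 2 := by field_simp

/-- Nesting of the intervals, coarse form: `t ∈ I(j, m+1) ⇒ t/N ∈ I(j/n, m)` (GR19 §4.1, observation 2). [cite: GajjarRadhakrishnan2019, §4.1] -/
theorem interval_nesting' {n : ℕ} (hn : 2 ≤ n) {m j : ℕ} {t : ℝ}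
    (ht1 : (alpha n (m + 1) j : ℝ) + 1 ≤ t) (ht2 : t ≤ (alpha n (m + 1) j : ℝ) + (n : ℝ) ^ 2 - 1) :
    (alpha n m (j / n) : ℝ) + 1 ≤ t / (n : ℝ) ^ 2 ∧
      t / (n : ℝ) ^ 2 ≤ (alpha n m (j / n) : ℝ) + (n : ℝ) ^ 2 - 1 := by
  obtain ⟨h1, h2⟩ := interval_nesting hn ht1 ht2
  have hN : (0 : ℝ) < (n : ℝ) ^ 2 := by positivity
  have hNinv : (0 : ℝ) < 1 / (n : ℝ) ^ 2 := by positivity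
  have hr : j % n < n := Nat.mod_lt _ (by omega)
  have hr' : ((j % n : ℕ) : ℝ) + 1 ≤ n := by exact_mod_cast (hr : j % n + 1 ≤ n)
  have hn' : (2 : ℝ) ≤ n := by exact_mod_cast hn
  have hr0 : (0 : ℝ) ≤ ((j % n : ℕ) : ℝ) := by positivity
  constructor
  · linarith
  · nlinarith

/-! ### Section C: the recursive construction (GR19 §4.2–4.3, non-planar version)

`graph n m B D` is the layered graph `G(B, D, m)` of GR19 Lemma 26 with the linking gadget
`L(B, n)` used directly (no planarization), and `path n m b j` is its dedicated walk `P_{bj}`.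
The constants are GR19 (27)–(30): `K_R = 20 N³ B`, `K_L = 400 N^{m+4} B²`,
`D_L = (N / 2K_L)(D − K_R / N)`, `D_R = 1` (their level `m` is our `m + 1`). -/

/-- The linking gadget `L(B, n)` of GR19 §3.1 with the weights (31):
`w_{b, b+r} = N D r b + K_R (r(r+1)/2 − r λ / N)`, arcs `b → b + r` for `b < B`, `0 ≤ r ≤ n`.
[cite: GajjarRadhakrishnan2019, §3.1 (31)] -/
def link (n B : ℕ) (D KR N : ℝ) : Layer where
  adj b c := b < B ∧ b ≤ c ∧ c ≤ b + n
  w b c := (N * D * ((c - b : ℕ) : ℝ) * b + KR * ((c - b : ℕ) : ℝ) * (((c - b : ℕ) : ℝ) + 1) / 2,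
    -(KR * ((c - b : ℕ) : ℝ) / N))

/-- `K_R = 20 N³ B` (GR19 (28)). [cite: GajjarRadhakrishnan2019, §4.3 (28)] -/
def KR (n B : ℕ) : ℝ := 20 * ((n : ℝ) ^ 2) ^ 3 * B

/-- `K_L = 400 N^{m+5} B²` (GR19 (27), their `m` being our `m + 1`).
[cite: GajjarRadhakrishnan2019, §4.3 (27)] -/
def KL (n B m : ℕ) : ℝ := 400 * ((n : ℝ) ^ 2) ^ (m + 5) * (B : ℝ) ^ 2

/-- `D_L = (N D − K_R) / (2 K_L)` (GR19 (29)). [cite: GajjarRadhakrishnan2019, §4.3 (29)] -/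
def DL (n B m : ℕ) (D : ℝ) : ℝ := ((n : ℝ) ^ 2 * D - KR n B) / (2 * KL n B m)

/-- The graph `G(B, D, m)` of GR19 Lemma 26: `G(B, D, 0)` is empty (every input is its own
one-vertex walk) and `G(B, D, m+1) = G^L ∘ G^M ∘ LINK ∘ G^R` with `G^L = K_L · G(B, D_L, m)(λ/N)`,
`G^M` its mirror image, and `G^R = K_R · G(B + n, 1, m)(λ/N)`.
[cite: GajjarRadhakrishnan2019, §4, Lemma 26] -/
def graph (n : ℕ) : ℕ → ℕ → ℝ → List Layer
  | 0, _, _ => []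
  | m + 1, B, D =>
    (graph n m B (DL n B m D)).map (Layer.smap (KL n B m) ((n : ℝ) ^ 2)) ++
    mirror ((graph n m B (DL n B m D)).map (Layer.smap (KL n B m) ((n : ℝ) ^ 2))) ++
    [link n B D (KR n B) ((n : ℝ) ^ 2)] ++
    (graph n m (B + n) 1).map (Layer.smap (KR n B) ((n : ℝ) ^ 2))

/-- The dedicated walk `P_{bj}` of GR19 (33) from input `b`, for `j = n·d + r`:
`P^L_{bd}`, then its mirror image back to `b`, the link arc `b → b + r + 1`, then `P^R_{b+r+1, d}`.
(It does not depend on `B` or `D`.) [cite: GajjarRadhakrishnan2019, §4.3 (33)] -/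
def path (n : ℕ) : ℕ → ℕ → ℕ → List ℕ
  | 0, _, _ => []
  | m + 1, b, j =>
    path n m b (j / n) ++ mirrorPath b (path n m b (j / n)) ++ [b + j % n + 1] ++
      path n m (b + j % n + 1) (j / n)

/-- Number of layers of `G(B, D, m)`: `len m = (3^m − 1)/2`.
[cite: GajjarRadhakrishnan2019, §4, Lemma 26] -/
def len : ℕ → ℕ
  | 0 => 0
  | m + 1 => 3 * len m + 1

/-- `2·len m + 1 = 3^m`. [folklore] -/
theorem two_mul_len_add_one : ∀ m, 2 * len m + 1 = 3 ^ m
  | 0 => rfl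
  | m + 1 => by rw [len, pow_succ, ← two_mul_len_add_one m]; ring

/-- `G(B, D, m)` has `len m` layers (property (i)). [cite: GajjarRadhakrishnan2019, §4, Lemma 26] -/
@[simp] theorem length_graph (n : ℕ) : ∀ m B D, (graph n m B D).length = len m
  | 0, _, _ => rfl
  | m + 1, B, D => by
    simp only [graph, List.length_append, List.length_map, length_mirror, length_graph n m,
      List.length_singleton, len]
    ring

/-- `P_{bj}` has one row per layer. [cite: GajjarRadhakrishnan2019, §4, Lemma 26] -/
@[simp] theorem length_path (n : ℕ) : ∀ m b j, (path n m b j).length = len m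
  | 0, _, _ => rfl
  | m + 1, b, j => by
    simp only [path, List.length_append, length_mirrorPath, length_path n m,
      List.length_singleton, len]
    ring

/-- All rows met by arcs of `G(B, D, m)` are `< B + m·n`.
[cite: GajjarRadhakrishnan2019, §4, Lemma 26] -/
theorem adj_bound (n : ℕ) : ∀ m B D, ∀ l ∈ graph n m B D, ∀ x y, l.adj x y →
    x < B + m * n ∧ y < B + m * n
  | 0, _, _, l, hl, _, _, _ => by simp [graph] at hl
  | m + 1, B, D, l, hl, x, y, hxy => by
    simp only [graph, List.append_assoc, List.mem_append, List.mem_map, List.mem_singleton,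
      mem_mirror] at hl
    rcases hl with ⟨l', hl', rfl⟩ | hl | rfl | ⟨l', hl', rfl⟩
    · have := adj_bound n m B _ l' hl' x y hxy
      constructor <;> nlinarith [this.1, this.2]
    · obtain ⟨a, ha, h3⟩ := hl
      have h4 : l = (a.smap (KL n B m) ((n : ℝ) ^ 2)).flip := by rw [h3, Layer.flip_flip]
      subst h4
      have hxy' : a.adj y x := hxy
      have := adj_bound n m B _ _ ha y x hxy'
      constructor <;> nlinarith [this.1, this.2]
    · simp only [link] at hxy
      constructor <;> nlinarith [hxy.1, hxy.2.1, hxy.2.2]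
    · have := adj_bound n m (B + n) 1 l' hl' x y hxy
      constructor <;> nlinarith [this.1, this.2]

/-- `P_{bj}` is a walk from input `b` through `G(B, D, m)` (`b < B`, `j < n^m`).
[cite: GajjarRadhakrishnan2019, §4, Lemma 26] -/
theorem isWalk_path {n : ℕ} (hn : 1 ≤ n) : ∀ m B D b j, b < B → j < n ^ m →
    IsWalk (graph n m B D) b (path n m b j)
  | 0, _, _, _, _, _, _ => by simp [graph, path]
  | m + 1, B, D, b, j, hb, hj => by
    have hd : j / n < n ^ m := by
      rw [Nat.div_lt_iff_lt_mul (by omega)]; simpa [pow_succ] using hj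
    have hr : j % n < n := Nat.mod_lt _ (by omega)
    have hL := isWalk_path hn m B (DL n B m D) b (j / n) hb hd
    have hR := isWalk_path hn m (B + n) 1 (b + j % n + 1) (j / n) (by omega) hd
    rw [graph, path]
    have h1 : (path n m b (j / n)).length =
        ((graph n m B (DL n B m D)).map (Layer.smap (KL n B m) ((n : ℝ) ^ 2))).length := by simp
    have h2 : (mirrorPath b (path n m b (j / n))).length =
        (mirror ((graph n m B (DL n B m D)).map (Layer.smap (KL n B m) ((n : ℝ) ^ 2)))).length := by
      simp
    have h3 : [b + j % n + 1].length = [link n B D (KR n B) ((n : ℝ) ^ 2)].length := by simp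
    rw [isWalk_append (by simp [h1, h2, h3]), isWalk_append (by simp [h1, h2]), isWalk_append h1]
    refine ⟨⟨⟨(isWalk_map_smap _ _ _ _ _).2 hL, ?_⟩, ?_⟩, ?_⟩
    · rw [mirror_map_smap, isWalk_map_smap]
      exact isWalk_mirror hL
    · rw [endpt_append, endpt_mirrorPath]
      simp only [isWalk_cons_cons, isWalk_nil_nil, and_true, link]
      omega
    · rw [endpt_append, endpt_append, endpt_mirrorPath]
      simp only [endpt_cons, endpt_nil]
      exact (isWalk_map_smap _ _ _ _ _).2 hR

/-- Property (v') (what GR19 (v) is used for): for fixed `j`, distinct inputs have dedicated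
walks with distinct endpoints. [cite: GajjarRadhakrishnan2019, §4, Lemma 26] -/
theorem endpt_path_injective (n : ℕ) : ∀ m j b b',
    endpt b (path n m b j) = endpt b' (path n m b' j) → b = b'
  | 0, _, _, _, h => by simpa [path] using h
  | m + 1, j, b, b', h => by
    simp only [path, endpt_append, endpt_mirrorPath, endpt_cons, endpt_nil] at h
    have := endpt_path_injective n m (j / n) _ _ h
    omega

/-- Property (vi): for fixed input, distinct `j < n^m` have distinct dedicated walks.
[cite: GajjarRadhakrishnan2019, §4, Lemma 26] -/
theorem path_injective {n : ℕ} (hn : 1 ≤ n) : ∀ m b j j', j < n ^ m → j' < n ^ m →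
    path n m b j = path n m b j' → j = j'
  | 0, _, j, j', hj, hj', _ => by simp at hj hj'; omega
  | m + 1, b, j, j', hj, hj', h => by
    have hd : j / n < n ^ m := by
      rw [Nat.div_lt_iff_lt_mul (by omega)]; simpa [pow_succ] using hj
    have hd' : j' / n < n ^ m := by
      rw [Nat.div_lt_iff_lt_mul (by omega)]; simpa [pow_succ] using hj'
    simp only [path] at h
    have hl1 : (path n m b (j / n) ++ mirrorPath b (path n m b (j / n))).length =
        (path n m b (j' / n) ++ mirrorPath b (path n m b (j' / n))).length := by simp
    have hl2 : (path n m b (j / n) ++ mirrorPath b (path n m b (j / n)) ++ [b + j % n + 1]).length =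
        (path n m b (j' / n) ++ mirrorPath b (path n m b (j' / n)) ++ [b + j' % n + 1]).length := by
      simp
    obtain ⟨h12, _⟩ := List.append_inj h hl2
    obtain ⟨h1, h2⟩ := List.append_inj h12 hl1
    obtain ⟨hP, _⟩ := List.append_inj h1 (by simp)
    have hdd := path_injective hn m b _ _ hd hd' hP
    have hrr : j % n = j' % n := by
      have := List.singleton_inj.1 h2
      omega
    rw [← Nat.div_add_mod j n, ← Nat.div_add_mod j' n, hdd, hrr]

/-- `K_R > 0`. [cite: GajjarRadhakrishnan2019, §4, Lemma 26] -/
theorem KR_pos {n B : ℕ} (hn : 1 ≤ n) (hB : 1 ≤ B) : 0 < KR n B := by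
  unfold KR
  have : (1 : ℝ) ≤ n := by exact_mod_cast hn
  have : (1 : ℝ) ≤ B := by exact_mod_cast hB
  positivity

/-- `K_L > 0`. [cite: GajjarRadhakrishnan2019, §4, Lemma 26] -/
theorem KL_pos {n B : ℕ} (m : ℕ) (hn : 1 ≤ n) (hB : 1 ≤ B) : 0 < KL n B m := by
  unfold KL
  have : (1 : ℝ) ≤ n := by exact_mod_cast hn
  have : (1 : ℝ) ≤ B := by exact_mod_cast hB
  positivity

/-- `2 K_L D_L = N D − K_R` (the defining identity of `D_L`). [cite: GajjarRadhakrishnan2019, §4.3 (29)] -/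
theorem two_KL_mul_DL {n B : ℕ} (m : ℕ) (D : ℝ) (hn : 1 ≤ n) (hB : 1 ≤ B) :
    2 * KL n B m * DL n B m D = (n : ℝ) ^ 2 * D - KR n B := by
  have := KL_pos m hn hB
  unfold DL
  field_simp

/-- Cost of the dedicated walk, unfolded one level. [cite: GajjarRadhakrishnan2019, §4, Lemma 26] -/
theorem cost_path_succ (n m B : ℕ) (D : ℝ) (b j : ℕ) :
    cost (graph n (m + 1) B D) b (path n (m + 1) b j) =
      (2 * KL n B m * (cost (graph n m B (DL n B m D)) b (path n m b (j / n))).1,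
        2 * KL n B m * (cost (graph n m B (DL n B m D)) b (path n m b (j / n))).2 / (n : ℝ) ^ 2) +
      (link n B D (KR n B) ((n : ℝ) ^ 2)).w b (b + j % n + 1) +
      (KR n B * (cost (graph n m (B + n) 1) (b + j % n + 1) (path n m (b + j % n + 1) (j / n))).1,
        KR n B * (cost (graph n m (B + n) 1) (b + j % n + 1)
          (path n m (b + j % n + 1) (j / n))).2 / (n : ℝ) ^ 2) := by
  rw [graph, path]
  have h1 : (path n m b (j / n)).length =
      ((graph n m B (DL n B m D)).map (Layer.smap (KL n B m) ((n : ℝ) ^ 2))).length := by simp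
  have h2 : (mirrorPath b (path n m b (j / n))).length =
      (mirror ((graph n m B (DL n B m D)).map (Layer.smap (KL n B m) ((n : ℝ) ^ 2)))).length := by
    simp
  have h3 : [b + j % n + 1].length = [link n B D (KR n B) ((n : ℝ) ^ 2)].length := by simp
  rw [cost_append (by simp [h1, h2, h3]), cost_append (by simp [h1, h2]), cost_append h1,
    endpt_append, endpt_append, endpt_mirrorPath, cost_mirror (by simp),
    cost_map_smap, cost_map_smap]
  simp only [endpt_cons, endpt_nil, cost_cons_cons, cost_nil, add_zero, Prod.mk_add_mk]
  ext <;> simp <;> ring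

/-- Property (iv) of GR19 Lemma 26: `C(P_{bj}) = C(P_{0j}) + b·D·α(j, m)` (a constant shift).
[cite: GajjarRadhakrishnan2019, §4.3, property (iv)] -/
theorem cost_path_shift {n : ℕ} (hn : 1 ≤ n) : ∀ m B D b j, 1 ≤ B →
    cost (graph n m B D) b (path n m b j) =
      cost (graph n m B D) 0 (path n m 0 j) + ((b : ℝ) * D * alpha n m j, 0)
  | 0, _, _, _, _, _ => by simp [graph, path, Prod.ext_iff]
  | m + 1, B, D, b, j, hB => by
    have ihL := cost_path_shift hn m B (DL n B m D) b (j / n) hB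
    have ihR := cost_path_shift hn m (B + n) 1 (b + j % n + 1) (j / n) (by omega)
    have ihR0 := cost_path_shift hn m (B + n) 1 (0 + j % n + 1) (j / n) (by omega)
    have hKD := two_KL_mul_DL m D hn hB
    rw [cost_path_succ, cost_path_succ, ihL, ihR, ihR0, alpha_succ]
    have e1 : (b + j % n + 1 - b : ℕ) = j % n + 1 := by omega
    have e0 : (0 + j % n + 1 - 0 : ℕ) = j % n + 1 := by omega
    refine Prod.ext ?_ ?_
    · simp only [link, e1, e0, Prod.fst_add]
      push_cast
      linear_combination ((b : ℝ) * (alpha n m (j / n) : ℝ)) * hKD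
    · simp only [link, e1, e0, Prod.snd_add]
      push_cast
      ring

/-! ### Section D: property (iii) of GR19 Lemma 26 — the dedicated walk wins by a margin

Numerical bookkeeping first (the constants have a lot of slack), then the decomposition of an
arbitrary walk through `G(B, D, m+1)` into its four segments, then the main induction. -/

section Numerics

variable {ν β P D : ℝ}

/-- Auxiliary: `ν² ≤ ν⁶ β` for `ν ≥ 2`, `β ≥ 1`. [folklore] -/
theorem num_aux1 (hν : 2 ≤ ν) (hβ : 1 ≤ β) : ν ^ 2 ≤ (ν ^ 2) ^ 3 * β := by
  have hν2 : (1 : ℝ) ≤ ν ^ 2 := by nlinarith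
  have h1 : ν ^ 2 ≤ (ν ^ 2) ^ 3 := by
    have : (0 : ℝ) ≤ ν ^ 2 * ((ν ^ 2) ^ 2 - 1) := mul_nonneg (by positivity) (by nlinarith)
    nlinarith
  exact h1.trans (le_mul_of_one_le_right (by positivity) hβ)

/-- `|D_L|·B·N^{m+1} ≤ 1/4` (used for Term III of GR19 Claim 34) in polynomial form.
[cite: GajjarRadhakrishnan2019, §4.3] -/
theorem num_DL_small (hν : 2 ≤ ν) (hβ : 1 ≤ β) (hP : ν ^ 2 ≤ P) (hD : |D| ≤ 1) :
    β * (|ν ^ 2 * D - 20 * (ν ^ 2) ^ 3 * β| / (2 * (400 * (P * (ν ^ 2) ^ 4) * β ^ 2))) * P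
      ≤ 1 / 4 := by
  have hν1 : (1 : ℝ) ≤ ν := by linarith
  have hν2 : (1 : ℝ) ≤ ν ^ 2 := one_le_pow₀ hν1
  have hP1 : (1 : ℝ) ≤ P := le_trans (by nlinarith) hP
  have hK : (0 : ℝ) < 2 * (400 * (P * (ν ^ 2) ^ 4) * β ^ 2) := by positivity
  have habs : |ν ^ 2 * D - 20 * (ν ^ 2) ^ 3 * β| ≤ ν ^ 2 + 20 * (ν ^ 2) ^ 3 * β := by
    have h1 : |ν ^ 2 * D| ≤ ν ^ 2 := by
      rw [abs_mul, abs_of_nonneg (by positivity : (0 : ℝ) ≤ ν ^ 2)]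
      nlinarith
    have h2 : |20 * (ν ^ 2) ^ 3 * β| = 20 * (ν ^ 2) ^ 3 * β := abs_of_nonneg (by positivity)
    calc |ν ^ 2 * D - 20 * (ν ^ 2) ^ 3 * β| ≤ |ν ^ 2 * D| + |20 * (ν ^ 2) ^ 3 * β| := abs_sub _ _
      _ ≤ _ := by rw [h2]; linarith
  rw [mul_div_assoc', div_mul_eq_mul_div, div_le_iff₀ hK]
  have h3 : β * (ν ^ 2 + 20 * (ν ^ 2) ^ 3 * β) * P ≤ 21 * ((ν ^ 2) ^ 3 * β ^ 2 * P) := by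
    have key : β * P * ν ^ 2 ≤ β * P * ((ν ^ 2) ^ 3 * β) :=
      mul_le_mul_of_nonneg_left (num_aux1 hν hβ) (by positivity)
    nlinarith [key]
  have h4 : (ν ^ 2) ^ 3 * β ^ 2 * P ≤ (ν ^ 2) ^ 4 * β ^ 2 * P := by
    have : (ν ^ 2) ^ 3 ≤ (ν ^ 2) ^ 4 := pow_le_pow_right₀ hν2 (by norm_num)
    have : (0 : ℝ) ≤ β ^ 2 * P := by positivity
    nlinarith
  have h5 : (0 : ℝ) ≤ (ν ^ 2) ^ 4 * β ^ 2 * P := by positivity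
  calc β * |ν ^ 2 * D - 20 * (ν ^ 2) ^ 3 * β| * P
      ≤ β * (ν ^ 2 + 20 * (ν ^ 2) ^ 3 * β) * P := by gcongr
    _ ≤ 21 * ((ν ^ 2) ^ 4 * β ^ 2 * P) := by linarith
    _ ≤ 1 / 4 * (2 * (400 * (P * (ν ^ 2) ^ 4) * β ^ 2)) := by nlinarith

/-- `|D_L| ≤ 1`. [cite: GajjarRadhakrishnan2019, §4.3] -/
theorem num_DL_le_one (hν : 2 ≤ ν) (hβ : 1 ≤ β) (hP : ν ^ 2 ≤ P) (hD : |D| ≤ 1) :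
    |(ν ^ 2 * D - 20 * (ν ^ 2) ^ 3 * β) / (2 * (400 * (P * (ν ^ 2) ^ 4) * β ^ 2))| ≤ 1 := by
  have hν1 : (1 : ℝ) ≤ ν := by linarith
  have hP1 : (1 : ℝ) ≤ P := le_trans (by nlinarith) hP
  have hK : (0 : ℝ) < 2 * (400 * (P * (ν ^ 2) ^ 4) * β ^ 2) := by positivity
  have h := num_DL_small hν hβ hP hD
  rw [abs_div, abs_of_pos hK]
  have h0 : 0 ≤ |ν ^ 2 * D - 20 * (ν ^ 2) ^ 3 * β| / (2 * (400 * (P * (ν ^ 2) ^ 4) * β ^ 2)) := by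
    positivity
  have h1 : |ν ^ 2 * D - 20 * (ν ^ 2) ^ 3 * β| / (2 * (400 * (P * (ν ^ 2) ^ 4) * β ^ 2)) ≤
      β * (|ν ^ 2 * D - 20 * (ν ^ 2) ^ 3 * β| / (2 * (400 * (P * (ν ^ 2) ^ 4) * β ^ 2))) * P := by
    calc |ν ^ 2 * D - 20 * (ν ^ 2) ^ 3 * β| / (2 * (400 * (P * (ν ^ 2) ^ 4) * β ^ 2))
        = 1 * (|ν ^ 2 * D - 20 * (ν ^ 2) ^ 3 * β| / (2 * (400 * (P * (ν ^ 2) ^ 4) * β ^ 2))) * 1 := by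
          ring
      _ ≤ _ := by gcongr
  linarith

/-- The link-monotonicity margin `K_R / N − N B ≥ 1` (GR19 (43)–(44)).
[cite: GajjarRadhakrishnan2019, §4.3] -/
theorem num_link_margin (hν : 2 ≤ ν) (hβ : 1 ≤ β) :
    1 ≤ 20 * (ν ^ 2) ^ 3 * β / ν ^ 2 - ν ^ 2 * β := by
  have hν2 : (4 : ℝ) ≤ ν ^ 2 := by nlinarith
  have hne : ν ^ 2 ≠ 0 := by positivity
  have h : 20 * (ν ^ 2) ^ 3 * β / ν ^ 2 - ν ^ 2 * β = ν ^ 2 * β * (20 * ν ^ 2 - 1) := by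
    field_simp
  rw [h]
  have h1 : (4 : ℝ) ≤ ν ^ 2 * β := by nlinarith
  have h3 : (79 : ℝ) ≤ 20 * ν ^ 2 - 1 := by linarith
  calc (1 : ℝ) ≤ 4 * 79 := by norm_num
    _ ≤ ν ^ 2 * β * (20 * ν ^ 2 - 1) := mul_le_mul h1 h3 (by norm_num) (by positivity)

/-- The bound on all the non-prefix terms in Case A (GR19: "`|C(P₁) − C(P₂)| ≤ K_L / 10`").
[cite: GajjarRadhakrishnan2019, §4.3] -/
theorem num_caseA (hν : 2 ≤ ν) (hβ : 1 ≤ β) (hP : ν ^ 2 ≤ P) :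
    20 * (ν ^ 2) ^ 3 * β * (ν ^ 2 + ν * P + P * (β + ν)) + 2 * (ν ^ 2 * ν * β) + 1
      ≤ 300 * (P * (ν ^ 2) ^ 4) * β ^ 2 := by
  have hν1 : (1 : ℝ) ≤ ν := by linarith
  have hν2 : (1 : ℝ) ≤ ν ^ 2 := one_le_pow₀ hν1
  have hP1 : (1 : ℝ) ≤ P := le_trans (by nlinarith) hP
  have hX : (1 : ℝ) ≤ (ν ^ 2) ^ 4 * β ^ 2 * P := by
    have : (1 : ℝ) ≤ (ν ^ 2) ^ 4 := one_le_pow₀ hν2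
    have : (1 : ℝ) ≤ (ν ^ 2) ^ 4 * β ^ 2 := by nlinarith
    nlinarith
  -- each term is at most X := (ν²)⁴ β² P
  have t1 : (ν ^ 2) ^ 3 * β * ν ^ 2 ≤ (ν ^ 2) ^ 4 * β ^ 2 * P := by
    have e : (ν ^ 2) ^ 4 * β ^ 2 * P - (ν ^ 2) ^ 3 * β * ν ^ 2
        = (ν ^ 2) ^ 4 * β * (β * P - 1) := by ring
    have : (0 : ℝ) ≤ β * P - 1 := by nlinarith
    have : (0 : ℝ) ≤ (ν ^ 2) ^ 4 * β := by positivity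
    nlinarith
  have t2 : (ν ^ 2) ^ 3 * β * (ν * P) ≤ (ν ^ 2) ^ 4 * β ^ 2 * P := by
    have e : (ν ^ 2) ^ 4 * β ^ 2 * P - (ν ^ 2) ^ 3 * β * (ν * P)
        = (ν ^ 2) ^ 3 * β * P * (ν * (ν * β) - ν) := by ring
    have : (0 : ℝ) ≤ ν * (ν * β) - ν := by nlinarith
    have : (0 : ℝ) ≤ (ν ^ 2) ^ 3 * β * P := by positivity
    nlinarith
  have t3 : (ν ^ 2) ^ 3 * β * (P * β) ≤ (ν ^ 2) ^ 4 * β ^ 2 * P := by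
    have e : (ν ^ 2) ^ 4 * β ^ 2 * P - (ν ^ 2) ^ 3 * β * (P * β)
        = (ν ^ 2) ^ 3 * β ^ 2 * P * (ν ^ 2 - 1) := by ring
    have : (0 : ℝ) ≤ (ν ^ 2) ^ 3 * β ^ 2 * P := by positivity
    have : (0 : ℝ) ≤ ν ^ 2 - 1 := by linarith
    nlinarith
  have t4 : (ν ^ 2) ^ 3 * β * (P * ν) ≤ (ν ^ 2) ^ 4 * β ^ 2 * P := by linarith [t2]
  have t5 : ν ^ 2 * ν * β ≤ (ν ^ 2) ^ 4 * β ^ 2 * P := by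
    have e : (ν ^ 2) ^ 4 * β ^ 2 * P - ν ^ 2 * ν * β
        = ν ^ 2 * ν * β * (ν ^ 3 * ν ^ 2 * β * P - 1) := by ring
    have : (1 : ℝ) ≤ ν ^ 3 * ν ^ 2 * β * P := by
      have h1 : (1 : ℝ) ≤ ν ^ 3 := one_le_pow₀ hν1
      have h2 : (1 : ℝ) ≤ ν ^ 3 * ν ^ 2 := by nlinarith
      have h3 : (1 : ℝ) ≤ ν ^ 3 * ν ^ 2 * β := by nlinarith
      nlinarith
    have : (0 : ℝ) ≤ ν ^ 2 * ν * β := by positivity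
    nlinarith
  nlinarith

end Numerics

/-- Value of a link weight: `w_{c, c+k}(t) = N D k c + K_R k(k+1)/2 − K_R k (t/N)`.
[cite: GajjarRadhakrishnan2019, §3.1 (31)] -/
theorem eval_link_w (n B : ℕ) (D R : ℝ) {N : ℝ} (hN : N ≠ 0) (c c' : ℕ) (t : ℝ) :
    eval ((link n B D R N).w c c') t =
      N * D * ((c' - c : ℕ) : ℝ) * c + R * ((c' - c : ℕ) : ℝ) * (((c' - c : ℕ) : ℝ) + 1) / 2
        - R * ((c' - c : ℕ) : ℝ) * (t / N) := by
  simp only [link, eval]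
  field_simp
  ring

/-- A walk through `G(B, D, m+1)` splits into its four segments: through `G^L`, through the
mirror image `G^M`, one link arc, and through `G^R`.
[cite: GajjarRadhakrishnan2019, §4, Lemma 26] -/
theorem walk_split {n m B : ℕ} {D : ℝ} {b : ℕ} {q : List ℕ}
    (h : IsWalk (graph n (m + 1) B D) b q) :
    ∃ q₁ q₂ c' q₃, q = q₁ ++ q₂ ++ [c'] ++ q₃ ∧
      IsWalk (graph n m B (DL n B m D)) b q₁ ∧
      IsWalk (mirror (graph n m B (DL n B m D))) (endpt b q₁) q₂ ∧
      (link n B D (KR n B) ((n : ℝ) ^ 2)).adj (endpt (endpt b q₁) q₂) c' ∧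
      IsWalk (graph n m (B + n) 1) c' q₃ := by
  rw [graph] at h
  obtain ⟨q123, q₃, rfl, -, h123, h3⟩ := isWalk_append_split h
  obtain ⟨q12, qk, rfl, -, h12, hk⟩ := isWalk_append_split h123
  obtain ⟨q₁, q₂, rfl, -, h1, h2⟩ := isWalk_append_split h12
  cases qk with
  | nil => exact absurd hk (by simp)
  | cons c' rest =>
    simp only [isWalk_cons_cons, isWalk_nil_iff] at hk
    obtain ⟨hadj, rfl⟩ := hk
    refine ⟨q₁, q₂, c', q₃, rfl, (isWalk_map_smap _ _ _ _ _).1 h1, ?_, ?_, ?_⟩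
    · rw [mirror_map_smap, isWalk_map_smap] at h2; exact h2
    · rw [endpt_append] at hadj; exact hadj
    · rw [endpt_append, endpt_append] at h3
      simpa [isWalk_map_smap] using h3

/-- Cost of a four-segment row sequence through `G(B, D, m+1)`.
[cite: GajjarRadhakrishnan2019, §4, Lemma 26] -/
theorem cost_split (n m B : ℕ) (D : ℝ) (b : ℕ) {q₁ q₂ : List ℕ} (c' : ℕ) (q₃ : List ℕ)
    (h1 : q₁.length = len m) (h2 : q₂.length = len m) :
    cost (graph n (m + 1) B D) b (q₁ ++ q₂ ++ [c'] ++ q₃) =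
      (KL n B m * (cost (graph n m B (DL n B m D)) b q₁).1,
        KL n B m * (cost (graph n m B (DL n B m D)) b q₁).2 / (n : ℝ) ^ 2) +
      (KL n B m * (cost (mirror (graph n m B (DL n B m D))) (endpt b q₁) q₂).1,
        KL n B m * (cost (mirror (graph n m B (DL n B m D))) (endpt b q₁) q₂).2 / (n : ℝ) ^ 2) +
      (link n B D (KR n B) ((n : ℝ) ^ 2)).w (endpt (endpt b q₁) q₂) c' +
      (KR n B * (cost (graph n m (B + n) 1) c' q₃).1,
        KR n B * (cost (graph n m (B + n) 1) c' q₃).2 / (n : ℝ) ^ 2) := by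
  rw [graph]
  rw [cost_append (by simp [h1, h2]), cost_append (by simp [h1, h2]), cost_append (by simp [h1]),
    endpt_append, endpt_append, mirror_map_smap, cost_map_smap, cost_map_smap, cost_map_smap]
  simp only [endpt_cons, endpt_nil, cost_cons_cons, cost_nil, add_zero]

section Assembly

/-- Pure arithmetic of Case B2 (GR19 Claim 35, (37)–(44)): moving the link arc from slope
`r₀ = r + 1` to any other slope `k` costs at least `1`. [cite: GajjarRadhakrishnan2019, §4.3] -/
theorem num_caseB2 {R N M X s k r₀ : ℝ} (hR : 0 ≤ R) (hmargin : 1 ≤ R / N - M)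
    (hX : |X| ≤ M) (hs1 : r₀ + 1 / N ≤ s) (hs2 : s ≤ r₀ + 1 - 1 / N)
    (hk : k ≤ r₀ - 1 ∨ r₀ + 1 ≤ k) :
    1 ≤ (k - r₀) * (R * ((k + r₀ + 1) / 2 - s) + X) := by
  have hXl := neg_abs_le X
  have hXu := le_abs_self X
  rcases hk with hk | hk
  · have h1 : (k + r₀ + 1) / 2 - s ≤ -(1 / N) := by linarith
    have h2 : R * ((k + r₀ + 1) / 2 - s) ≤ R * (-(1 / N)) := mul_le_mul_of_nonneg_left h1 hR
    have h3 : R * ((k + r₀ + 1) / 2 - s) + X ≤ -1 := by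
      have : R * (-(1 / N)) = -(R / N) := by ring
      linarith
    have h4 : 1 ≤ -(k - r₀) := by linarith
    have h5 : 1 ≤ -(R * ((k + r₀ + 1) / 2 - s) + X) := by linarith
    calc (1 : ℝ) = 1 * 1 := by ring
      _ ≤ -(k - r₀) * -(R * ((k + r₀ + 1) / 2 - s) + X) := mul_le_mul h4 h5 zero_le_one (by linarith)
      _ = _ := by ring
  · have h1 : 1 / N ≤ (k + r₀ + 1) / 2 - s := by linarith
    have h2 : R * (1 / N) ≤ R * ((k + r₀ + 1) / 2 - s) := mul_le_mul_of_nonneg_left h1 hR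
    have h3 : 1 ≤ R * ((k + r₀ + 1) / 2 - s) + X := by
      have : R * (1 / N) = R / N := by ring
      linarith
    have h4 : 1 ≤ k - r₀ := by linarith
    calc (1 : ℝ) = 1 * 1 := by ring
      _ ≤ (k - r₀) * (R * ((k + r₀ + 1) / 2 - s) + X) := mul_le_mul h4 h3 zero_le_one (by linarith)

/-- The telescoped identity behind Case B2: with `w(k) = N D k b + R k(k+1)/2 − R k μ` the link
weight and `R k α_d` the input-shift of `G^R`,
`[w(k) + R k α] − [w(r₀) + R r₀ α] = (k − r₀)(R((k + r₀ + 1)/2 − (μ − α)) + N D b)`.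
[cite: GajjarRadhakrishnan2019, §4.3] -/
theorem num_caseB2_identity (R N D b μ α k r₀ : ℝ) :
    (N * D * k * b + R * k * (k + 1) / 2 - R * k * μ + R * k * α) -
      (N * D * r₀ * b + R * r₀ * (r₀ + 1) / 2 - R * r₀ * μ + R * r₀ * α) =
    (k - r₀) * (R * ((k + r₀ + 1) / 2 - (μ - α)) + N * D * b) := by
  ring

/-- Pure arithmetic of Case A: all the non-prefix terms are small compared with `(3/4)·K_L`.
[cite: GajjarRadhakrishnan2019, §4.3] -/
theorem num_caseA_terms {ν β P D R μ α b c k r₀ : ℝ} (hν : 2 ≤ ν) (hβ : 1 ≤ β)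
    (hP : ν ^ 2 ≤ P) (hD : |D| ≤ 1) (hR : R = 20 * (ν ^ 2) ^ 3 * β)
    (hb : 0 ≤ b ∧ b ≤ β) (hc : 0 ≤ c ∧ c ≤ β) (hk : 0 ≤ k ∧ k ≤ ν) (hr : 0 ≤ r₀ ∧ r₀ ≤ ν)
    (hμ : 0 ≤ μ ∧ μ ≤ P) (hα : 0 ≤ α ∧ α ≤ P) :
    (ν ^ 2 * D * r₀ * b + R * r₀ * (r₀ + 1) / 2 - R * r₀ * μ) -
      (ν ^ 2 * D * k * c + R * k * (k + 1) / 2 - R * k * μ) +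
      R * ((b + r₀) - (c + k)) * α + 1 ≤ 300 * (P * (ν ^ 2) ^ 4) * β ^ 2 := by
  have hν0 : (0 : ℝ) ≤ ν := by linarith
  have hR0 : 0 ≤ R := by rw [hR]; positivity
  have hDl := neg_abs_le D
  have hDu := le_abs_self D
  -- term 1: ν² D (r₀ b − k c) ≤ 2 ν² ν β
  have t1 : ν ^ 2 * D * r₀ * b - ν ^ 2 * D * k * c ≤ 2 * (ν ^ 2 * ν * β) := by
    have e : ν ^ 2 * D * r₀ * b - ν ^ 2 * D * k * c = ν ^ 2 * (D * (r₀ * b) + (-D) * (k * c)) := by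
      ring
    rw [e]
    have h1 : D * (r₀ * b) ≤ ν * β := by
      have : r₀ * b ≤ ν * β := mul_le_mul hr.2 hb.2 hb.1 hν0
      have : 0 ≤ r₀ * b := mul_nonneg hr.1 hb.1
      nlinarith
    have h2 : (-D) * (k * c) ≤ ν * β := by
      have : k * c ≤ ν * β := mul_le_mul hk.2 hc.2 hc.1 hν0
      have : 0 ≤ k * c := mul_nonneg hk.1 hc.1
      nlinarith
    have : (0 : ℝ) ≤ ν ^ 2 := by positivity
    nlinarith
  -- term 2: R r₀(r₀+1)/2 − R k(k+1)/2 ≤ R ν²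
  have t2 : R * r₀ * (r₀ + 1) / 2 - R * k * (k + 1) / 2 ≤ R * ν ^ 2 := by
    have h1 : r₀ * (r₀ + 1) / 2 ≤ ν ^ 2 := by nlinarith
    have h2 : 0 ≤ k * (k + 1) / 2 := by nlinarith
    have e : R * r₀ * (r₀ + 1) / 2 - R * k * (k + 1) / 2 = R * (r₀ * (r₀ + 1) / 2 - k * (k + 1) / 2) := by
      ring
    rw [e]
    exact mul_le_mul_of_nonneg_left (by linarith) hR0
  -- term 3: −R r₀ μ + R k μ ≤ R ν P
  have t3 : -(R * r₀ * μ) + R * k * μ ≤ R * (ν * P) := by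
    have e : -(R * r₀ * μ) + R * k * μ = R * ((k - r₀) * μ) := by ring
    rw [e]
    refine mul_le_mul_of_nonneg_left ?_ hR0
    have : (k - r₀) * μ ≤ ν * μ := mul_le_mul_of_nonneg_right (by linarith) hμ.1
    nlinarith
  -- term 4: R ((b + r₀) − (c + k)) α ≤ R (β + ν) P
  have t4 : R * ((b + r₀) - (c + k)) * α ≤ R * (P * (β + ν)) := by
    have e : R * ((b + r₀) - (c + k)) * α = R * (((b + r₀) - (c + k)) * α) := by ring
    rw [e]
    refine mul_le_mul_of_nonneg_left ?_ hR0
    have : ((b + r₀) - (c + k)) * α ≤ (β + ν) * α := mul_le_mul_of_nonneg_right (by linarith) hα.1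
    nlinarith
  have h := num_caseA hν hβ hP
  rw [← hR] at h
  nlinarith

/-- `|(c − b)·D_L·α_d| ≤ 1/4` from `B·|D_L|·N^{m+1} ≤ 1/4`. [cite: GajjarRadhakrishnan2019, §4.3] -/
theorem num_termIII {β S P α b c : ℝ} (h : β * (|S| * P) ≤ 1 / 4) (hb : 0 ≤ b ∧ b ≤ β)
    (hc : 0 ≤ c ∧ c ≤ β) (hα : 0 ≤ α ∧ α ≤ P) : |(c - b) * S * α| ≤ 1 / 4 := by
  rw [abs_mul, abs_mul]
  have h1 : |c - b| ≤ β := by rw [abs_le]; constructor <;> linarith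
  have h2 : |α| ≤ P := by rw [abs_of_nonneg hα.1]; exact hα.2
  calc |c - b| * |S| * |α| ≤ β * |S| * P :=
        mul_le_mul (mul_le_mul_of_nonneg_right h1 (abs_nonneg _)) h2 (abs_nonneg _) (by
          have := abs_nonneg S; nlinarith [hb.1, hb.2])
    _ = β * (|S| * P) := by ring
    _ ≤ 1 / 4 := h

end Assembly

set_option maxHeartbeats 1000000 in
/-- The inductive step of property (iii) (GR19 §4.3, Claims 34 and 35 and the final assembly).
[cite: GajjarRadhakrishnan2019, §4.3] -/
theorem main_step {n : ℕ} (hn : 2 ≤ n) (m : ℕ)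
    (IH : ∀ (B : ℕ) (D : ℝ) (b j : ℕ) (t : ℝ) (q : List ℕ),
      |D| ≤ 1 → b < B → j < n ^ m →
      (alpha n m j : ℝ) + 1 ≤ t → t ≤ (alpha n m j : ℝ) + (n : ℝ) ^ 2 - 1 →
      IsWalk (graph n m B D) b q → q ≠ path n m b j →
      eval (cost (graph n m B D) b (path n m b j)) t + 1 ≤ eval (cost (graph n m B D) b q) t)
    (B : ℕ) (D : ℝ) (b j : ℕ) (t : ℝ) (q : List ℕ) (hD : |D| ≤ 1) (hb : b < B)
    (hj : j < n ^ (m + 1)) (ht1 : (alpha n (m + 1) j : ℝ) + 1 ≤ t)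
    (ht2 : t ≤ (alpha n (m + 1) j : ℝ) + (n : ℝ) ^ 2 - 1)
    (hq : IsWalk (graph n (m + 1) B D) b q) (hne : q ≠ path n (m + 1) b j) :
    eval (cost (graph n (m + 1) B D) b (path n (m + 1) b j)) t + 1 ≤
      eval (cost (graph n (m + 1) B D) b q) t := by
  have hn1 : 1 ≤ n := by omega
  have hB : 1 ≤ B := by omega
  have hνR : (2 : ℝ) ≤ n := by exact_mod_cast hn
  have hBR : (1 : ℝ) ≤ (B : ℝ) := by exact_mod_cast hB
  have hbR : (b : ℝ) + 1 ≤ (B : ℝ) := by exact_mod_cast (hb : b + 1 ≤ B)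
  have hN4 : (4 : ℝ) ≤ (n : ℝ) ^ 2 := by nlinarith
  have hNpos : (0 : ℝ) < (n : ℝ) ^ 2 := by linarith
  have hNne : ((n : ℝ) ^ 2) ≠ 0 := hNpos.ne'
  have hdlt : j / n < n ^ m := by
    rw [Nat.div_lt_iff_lt_mul (by omega)]; simpa [pow_succ] using hj
  have hrlt : j % n < n := Nat.mod_lt _ (by omega)
  have hrR : ((j % n : ℕ) : ℝ) + 1 ≤ n := by exact_mod_cast (hrlt : j % n + 1 ≤ n)
  obtain ⟨hμ1, hμ2⟩ := interval_nesting' hn ht1 ht2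
  obtain ⟨hμ3, hμ4⟩ := interval_nesting hn ht1 ht2
  have hαd := alpha_bound_real hn m (j / n)
  have hα0 : (0 : ℝ) ≤ (alpha n m (j / n) : ℝ) := by positivity
  -- the constants
  have hKpos : 0 < KL n B m := KL_pos m hn1 hB
  have hRpos : 0 < KR n B := KR_pos hn1 hB
  have hK : KL n B m = 400 * (((n : ℝ) ^ 2) ^ (m + 1) * ((n : ℝ) ^ 2) ^ 4) * (B : ℝ) ^ 2 := by
    rw [KL]; ring
  have hR : KR n B = 20 * ((n : ℝ) ^ 2) ^ 3 * B := by rw [KR]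
  have hS : DL n B m D = ((n : ℝ) ^ 2 * D - 20 * ((n : ℝ) ^ 2) ^ 3 * B) /
      (2 * (400 * (((n : ℝ) ^ 2) ^ (m + 1) * ((n : ℝ) ^ 2) ^ 4) * (B : ℝ) ^ 2)) := by
    rw [DL, hK, KR]
  have hNP : (n : ℝ) ^ 2 ≤ ((n : ℝ) ^ 2) ^ (m + 1) := by linarith
  have hSabs : |DL n B m D| ≤ 1 := by rw [hS]; exact num_DL_le_one hνR hBR hNP hD
  have hSsmall : (B : ℝ) * (|DL n B m D| * ((n : ℝ) ^ 2) ^ (m + 1)) ≤ 1 / 4 := by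
    have hden : (0 : ℝ) <
        2 * (400 * (((n : ℝ) ^ 2) ^ (m + 1) * ((n : ℝ) ^ 2) ^ 4) * (B : ℝ) ^ 2) := by positivity
    have := num_DL_small hνR hBR hNP hD
    rw [hS, abs_div, abs_of_pos hden, ← mul_assoc]
    exact this
  have hmargin : 1 ≤ KR n B / (n : ℝ) ^ 2 - (n : ℝ) ^ 2 * B := by
    rw [hR]; exact num_link_margin hνR hBR
  -- decomposition of `q`
  obtain ⟨q₁, q₂, c', q₃, rfl, hq1, hq2, hadj, hq3⟩ := walk_split hq
  obtain ⟨hcB, hcc', hc'c⟩ := hadj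
  obtain ⟨hmp, hmpend, hmpcost⟩ := isWalk_of_mirror hq2
  obtain ⟨k, hk⟩ : ∃ k : ℕ, c' = endpt (endpt b q₁) q₂ + k :=
    ⟨c' - endpt (endpt b q₁) q₂, by omega⟩
  have hkn : k ≤ n := by omega
  have hc'B : c' < B + n := by omega
  have hcR : ((endpt (endpt b q₁) q₂ : ℕ) : ℝ) + 1 ≤ (B : ℝ) := by
    exact_mod_cast (hcB : endpt (endpt b q₁) q₂ + 1 ≤ B)
  have hkR : ((k : ℕ) : ℝ) ≤ n := by exact_mod_cast hkn
  have hlen1 : q₁.length = len m := by rw [hq1.length_eq, length_graph]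
  have hlen2 : q₂.length = len m := by rw [hq2.length_eq, length_mirror, length_graph]
  -- the two costs, evaluated at `t`
  have Eq_q := congrArg (fun z => eval z t) (cost_split n m B D b c' q₃ hlen1 hlen2)
  have Eq_P := congrArg (fun z => eval z t) (cost_path_succ n m B D b j)
  have hsub1 : c' - endpt (endpt b q₁) q₂ = k := by omega
  have hsub2 : b + j % n + 1 - b = j % n + 1 := by omega
  simp only [eval_add, eval_smap _ _ hNne, eval_link_w _ _ _ _ hNne, hsub1, hsub2, ← hmpcost]
    at Eq_q Eq_P
  push_cast at Eq_q Eq_P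
  rw [Eq_q, Eq_P]
  clear Eq_q Eq_P
  -- induction hypotheses and shifts one level down
  have shL : ∀ c'' : ℕ, eval (cost (graph n m B (DL n B m D)) c'' (path n m c'' (j / n)))
      (t / (n : ℝ) ^ 2) = eval (cost (graph n m B (DL n B m D)) 0 (path n m 0 (j / n)))
      (t / (n : ℝ) ^ 2) + (c'' : ℝ) * DL n B m D * (alpha n m (j / n) : ℝ) := by
    intro c''
    rw [cost_path_shift hn1 m B _ c'' _ hB, eval_add]
    simp [eval]
  have shR : ∀ c'' : ℕ, eval (cost (graph n m (B + n) 1) c'' (path n m c'' (j / n)))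
      (t / (n : ℝ) ^ 2) = eval (cost (graph n m (B + n) 1) 0 (path n m 0 (j / n)))
      (t / (n : ℝ) ^ 2) + (c'' : ℝ) * (alpha n m (j / n) : ℝ) := by
    intro c''
    rw [cost_path_shift hn1 m (B + n) 1 c'' _ (by omega), eval_add]
    simp [eval]
  have f1 : q₁ ≠ path n m b (j / n) →
      eval (cost (graph n m B (DL n B m D)) b (path n m b (j / n))) (t / (n : ℝ) ^ 2) + 1 ≤
        eval (cost (graph n m B (DL n B m D)) b q₁) (t / (n : ℝ) ^ 2) :=
    fun h => IH B _ b _ _ q₁ hSabs hb hdlt hμ1 hμ2 hq1 h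
  have f1' : eval (cost (graph n m B (DL n B m D)) b (path n m b (j / n))) (t / (n : ℝ) ^ 2) ≤
      eval (cost (graph n m B (DL n B m D)) b q₁) (t / (n : ℝ) ^ 2) := by
    by_cases h : q₁ = path n m b (j / n)
    · rw [h]
    · linarith [f1 h]
  have f2 : mirrorPath (endpt b q₁) q₂ ≠ path n m (endpt (endpt b q₁) q₂) (j / n) →
      eval (cost (graph n m B (DL n B m D)) (endpt (endpt b q₁) q₂)
        (path n m (endpt (endpt b q₁) q₂) (j / n))) (t / (n : ℝ) ^ 2) + 1 ≤
      eval (cost (graph n m B (DL n B m D)) (endpt (endpt b q₁) q₂)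
        (mirrorPath (endpt b q₁) q₂)) (t / (n : ℝ) ^ 2) :=
    fun h => IH B _ _ _ _ _ hSabs hcB hdlt hμ1 hμ2 hmp h
  have f2' : eval (cost (graph n m B (DL n B m D)) (endpt (endpt b q₁) q₂)
        (path n m (endpt (endpt b q₁) q₂) (j / n))) (t / (n : ℝ) ^ 2) ≤
      eval (cost (graph n m B (DL n B m D)) (endpt (endpt b q₁) q₂)
        (mirrorPath (endpt b q₁) q₂)) (t / (n : ℝ) ^ 2) := by
    by_cases h : mirrorPath (endpt b q₁) q₂ = path n m (endpt (endpt b q₁) q₂) (j / n)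
    · rw [h]
    · linarith [f2 h]
  have f3 : q₃ ≠ path n m c' (j / n) →
      eval (cost (graph n m (B + n) 1) c' (path n m c' (j / n))) (t / (n : ℝ) ^ 2) + 1 ≤
        eval (cost (graph n m (B + n) 1) c' q₃) (t / (n : ℝ) ^ 2) :=
    fun h => IH (B + n) 1 c' _ _ q₃ (by simp) hc'B hdlt hμ1 hμ2 hq3 h
  have f3' : eval (cost (graph n m (B + n) 1) c' (path n m c' (j / n))) (t / (n : ℝ) ^ 2) ≤
      eval (cost (graph n m (B + n) 1) c' q₃) (t / (n : ℝ) ^ 2) := by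
    by_cases h : q₃ = path n m c' (j / n)
    · rw [h]
    · linarith [f3 h]
  have f4 : |((endpt (endpt b q₁) q₂ : ℕ) - (b : ℝ)) * DL n B m D * (alpha n m (j / n) : ℝ)|
      ≤ 1 / 4 :=
    num_termIII hSsmall ⟨by positivity, by linarith⟩ ⟨by positivity, by linarith⟩ ⟨hα0, by linarith⟩
  have f4' := neg_abs_le (((endpt (endpt b q₁) q₂ : ℕ) - (b : ℝ)) * DL n B m D *
    (alpha n m (j / n) : ℝ))
  have shLc := shL (endpt (endpt b q₁) q₂)
  have shLb := shL b
  have shRc := shR c'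
  have shRb := shR (b + j % n + 1)
  push_cast at shRb
  -- Case distinction: does `q` follow `P_{bj}` through `G^L ∘ G^M`?
  by_cases hA : q₁ = path n m b (j / n) ∧ q₂ = mirrorPath b (path n m b (j / n))
  · -- Case B: same prefix; then the link arc or the `G^R`-segment differs
    obtain ⟨hA1, hA2⟩ := hA
    have hcb : endpt (endpt b q₁) q₂ = b := by rw [hA2, hA1, endpt_mirrorPath]
    have hmpP : mirrorPath (endpt b q₁) q₂ = path n m b (j / n) := by
      rw [hA2, hA1, mirrorPath_mirrorPath]
    have hne' : ¬ (c' = b + j % n + 1 ∧ q₃ = path n m (b + j % n + 1) (j / n)) := by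
      rintro ⟨h1, h2⟩
      apply hne
      rw [hA1, hA2, h1, h2, path]
    rw [hcb] at hk
    rw [hmpP, hcb, hA1]
    by_cases hB1 : c' = b + j % n + 1
    · -- Case B1: same link arc, different continuation in `G^R` (costs `≥ K_R ≥ 1` more)
      have hkr : k = j % n + 1 := by omega
      subst hkr
      subst hB1
      have f3s := f3 (fun h => hne' ⟨rfl, h⟩)
      rw [shRb] at f3s ⊢
      push_cast at f3s ⊢
      have hR1 : (1 : ℝ) ≤ KR n B := by
        rw [hR]
        have h1 : (1 : ℝ) ≤ ((n : ℝ) ^ 2) ^ 3 := one_le_pow₀ (by linarith)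
        calc (1 : ℝ) ≤ 20 * 1 * 1 := by norm_num
          _ ≤ 20 * ((n : ℝ) ^ 2) ^ 3 * (B : ℝ) := by gcongr
      have hmul := mul_le_mul_of_nonneg_left f3s hRpos.le
      linarith [hmul, hR1]
    · -- Case B2: a different link arc (GR19 Claim 35)
      have hkne : k ≠ j % n + 1 := fun h => hB1 (by omega)
      have hkor : (k : ℝ) ≤ ((j % n : ℕ) : ℝ) + 1 - 1 ∨ ((j % n : ℕ) : ℝ) + 1 + 1 ≤ k := by
        rcases Nat.lt_or_gt_of_ne hkne with h | h
        · left
          have : (k : ℝ) + 1 ≤ ((j % n : ℕ) : ℝ) + 1 := by exact_mod_cast h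
          linarith
        · right
          exact_mod_cast h
      rw [hk] at f3' shRc
      push_cast at f3' shRc
      rw [shRc] at f3'
      rw [shRb, hk]
      have hX : |(n : ℝ) ^ 2 * D * b| ≤ (n : ℝ) ^ 2 * B := by
        rw [abs_mul, abs_mul, abs_of_pos hNpos, abs_of_nonneg (by positivity : (0 : ℝ) ≤ b)]
        have : |D| * (b : ℝ) ≤ 1 * B := mul_le_mul hD (by linarith) (by positivity) zero_le_one
        have : (0 : ℝ) ≤ (n : ℝ) ^ 2 * (1 * B - |D| * b) := mul_nonneg hNpos.le (by linarith)
        linarith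
      have key := num_caseB2 (k := (k : ℝ)) (r₀ := ((j % n : ℕ) : ℝ) + 1)
        (s := t / (n : ℝ) ^ 2 - (alpha n m (j / n) : ℝ)) hRpos.le hmargin hX
        (by linarith) (by linarith) hkor
      have iden := num_caseB2_identity (KR n B) ((n : ℝ) ^ 2) D b (t / (n : ℝ) ^ 2)
        (alpha n m (j / n) : ℝ) k (((j % n : ℕ) : ℝ) + 1)
      have hmul := mul_le_mul_of_nonneg_left f3' hRpos.le
      linarith [hmul, key, iden]
  · -- Case A: the prefix differs (GR19 Claim 34): it costs `≥ (3/4) K_L` more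
    have hor : q₁ ≠ path n m b (j / n) ∨
        mirrorPath (endpt b q₁) q₂ ≠ path n m (endpt (endpt b q₁) q₂) (j / n) := by
      by_contra h
      push Not at h
      obtain ⟨h1, h2⟩ := h
      apply hA
      have hcb : endpt (endpt b q₁) q₂ = b := by
        apply endpt_path_injective n m (j / n)
        rw [← h2, hmpend, h1]
      refine ⟨h1, ?_⟩
      have h3 := mirrorPath_mirrorPath (endpt b q₁) q₂
      rw [h2, hcb] at h3
      exact h3.symm
    have hpre : 2 * eval (cost (graph n m B (DL n B m D)) b (path n m b (j / n))) (t / (n : ℝ) ^ 2)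
        + 3 / 4 ≤ eval (cost (graph n m B (DL n B m D)) b q₁) (t / (n : ℝ) ^ 2) +
        eval (cost (graph n m B (DL n B m D)) (endpt (endpt b q₁) q₂)
          (mirrorPath (endpt b q₁) q₂)) (t / (n : ℝ) ^ 2) := by
      rcases hor with h | h
      · have := f1 h
        linarith
      · have := f2 h
        linarith
    have hpreK := mul_le_mul_of_nonneg_left hpre hKpos.le
    rw [hk] at f3' shRc
    push_cast at f3' shRc
    rw [shRc] at f3'
    rw [shRb, hk]
    have fin := num_caseA_terms (b := (b : ℝ)) (c := ((endpt (endpt b q₁) q₂ : ℕ) : ℝ))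
      (k := (k : ℝ)) (r₀ := ((j % n : ℕ) : ℝ) + 1) (μ := t / (n : ℝ) ^ 2)
      (α := (alpha n m (j / n) : ℝ)) hνR hBR hNP hD hR
      ⟨by positivity, by linarith⟩ ⟨by positivity, by linarith⟩ ⟨by positivity, hkR⟩
      ⟨by positivity, hrR⟩ ⟨by linarith, by linarith⟩ ⟨hα0, by linarith⟩
    have hmul := mul_le_mul_of_nonneg_left f3' hRpos.le
    linarith [hmul, fin, hpreK, hK]

/-- **Property (iii) of GR19 Lemma 26.** For `t ∈ I(j, m)`, the dedicated walk `P_{bj}` is the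
unique cheapest walk from input `b < B` through `G(B, D, m)`, by a margin of at least `1`.
[cite: GajjarRadhakrishnan2019, §4.3, property (iii)] -/
theorem main_ineq {n : ℕ} (hn : 2 ≤ n) : ∀ (m B : ℕ) (D : ℝ) (b j : ℕ) (t : ℝ) (q : List ℕ),
    |D| ≤ 1 → b < B → j < n ^ m →
    (alpha n m j : ℝ) + 1 ≤ t → t ≤ (alpha n m j : ℝ) + (n : ℝ) ^ 2 - 1 →
    IsWalk (graph n m B D) b q → q ≠ path n m b j →
    eval (cost (graph n m B D) b (path n m b j)) t + 1 ≤ eval (cost (graph n m B D) b q) t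
  | 0, B, D, b, j, t, q, _, _, _, _, _, hq, hne => by
    exfalso
    simp only [graph, isWalk_nil_iff] at hq
    exact hne (by rw [hq]; simp [path])
  | m + 1, B, D, b, j, t, q, hD, hb, hj, ht1, ht2, hq, hne =>
    main_step hn m (main_ineq hn m) B D b j t q hD hb hj ht1 ht2 hq hne

/-! ### Section E: unique maximisers are vertices; counting vertices -/

section Extreme

variable {V : Type*} [AddCommGroup V] [Module ℝ V] [TopologicalSpace V]

/-- A point of `S` at which a continuous linear functional is strictly larger than at every other
point of `S` is an extreme point of `convexHull S` (indeed an exposed point). [folklore] -/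
theorem mem_extremePoints_convexHull_of_forall_lt (l : V →L[ℝ] ℝ) {S : Set V} {z : V}
    (hz : z ∈ S) (h : ∀ s ∈ S, s ≠ z → l s < l z) :
    z ∈ (convexHull ℝ S).extremePoints ℝ := by
  apply exposedPoints_subset_extremePoints
  refine ⟨subset_convexHull ℝ S hz, l, fun y hy => ?_⟩
  have hlin : IsLinearMap ℝ (fun x => l x) := (l : V →ₗ[ℝ] ℝ).isLinear
  have hle : ∀ y ∈ convexHull ℝ S, l y ≤ l z := fun y hy =>
    convexHull_min (fun s hs => show s ∈ {x | l x ≤ l z} from (by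
      by_cases hsz : s = z
      · simp [hsz]
      · exact (h s hs hsz).le)) (convex_halfSpace_le hlin (l z)) hy
  refine ⟨hle y hy, fun hzy => ?_⟩
  by_contra hyz
  set S' : Set V := S \ {z} with hS'
  have hS : S = insert z S' := by
    rw [hS', Set.insert_sdiff_singleton, Set.insert_eq_of_mem hz]
  have hlt : ∀ y ∈ convexHull ℝ S', l y < l z := fun y hy =>
    convexHull_min (fun s hs => show s ∈ {x | l x < l z} from h s hs.1 hs.2)
      (convex_halfSpace_lt hlin (l z)) hy
  by_cases hne : S'.Nonempty
  · rw [hS, convexHull_insert hne, mem_convexJoin] at hy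
    obtain ⟨a, ha, b, hb, hyab⟩ := hy
    rw [Set.mem_singleton_iff] at ha
    subst ha
    obtain ⟨p, q, hp, hq, hpq, rfl⟩ := hyab
    have hlb := hlt b hb
    have h1 : l (p • a + q • b) = p * l a + q * l b := by
      rw [map_add, map_smul, map_smul, smul_eq_mul, smul_eq_mul]
    rw [h1] at hzy
    rcases hq.lt_or_eq with hq' | hq'
    · have hp' : p = 1 - q := by linarith
      subst hp'
      have := mul_lt_mul_of_pos_left hlb hq'
      linarith
    · subst hq'
      rw [add_zero] at hpq
      subst hpq
      exact hyz (by simp)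
  · rw [Set.not_nonempty_iff_eq_empty] at hne
    rw [hS, hne, insert_empty_eq, convexHull_singleton, Set.mem_singleton_iff] at hy
    exact hyz hy

end Extreme

/-- Counting: `K` distinct members of a finite set force `K ≤ ncard`. [folklore] -/
theorem le_ncard_of_injOn_range {α : Type*} {E : Set α} (hE : E.Finite) (K : ℕ) (f : ℕ → α)
    (hf : ∀ j < K, f j ∈ E) (hinj : ∀ j < K, ∀ j' < K, f j = f j' → j = j') : K ≤ E.ncard := by
  classical
  have h1 : ((Finset.range K).image f).card = K := by
    rw [Finset.card_image_of_injOn, Finset.card_range]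
    intro j hj j' hj' h
    exact hinj j (by simpa using hj) j' (by simpa using hj') h
  have h2 : (((Finset.range K).image f : Finset α) : Set α) ⊆ E := by
    intro x hx
    rw [Finset.coe_image, Finset.coe_range] at hx
    obtain ⟨j, hj, rfl⟩ := hx
    exact hf j (by simpa using hj)
  calc K = ((Finset.range K).image f).card := h1.symm
    _ = (((Finset.range K).image f : Finset α) : Set α).ncard := (Set.ncard_coe_finset _).symm
    _ ≤ E.ncard := Set.ncard_le_ncard h2 hE

/-! ### Section F: walks as permutation matrices

A layered graph with `T` layers on rows `< W` is realised inside the permutations of `Fin ν`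
(`ν ≥ 1 + (T+1)·W`): the vertex `(i, x)` (column `i ≤ T`, row `x < W`) is the index
`1 + i·W + x` and the index `0` is an extra vertex `s`.  The allowed pattern of pairs
`(u, π u)` consists of the arc `s → (0, 0)`, the arcs of the graph, the return arcs `(T, x) → s`
and the loop at every index except `s`.  A permutation inside the pattern is one cycle through
`s` — a walk from row `0` — plus fixed points, and summing the arc weights over the pairs
`(u, π u)` gives the cost of that walk; a permutation leaving the pattern picks up a penalty. -/

/-- The `i`-th layer of `G` (a layer without arcs if `i ≥ |G|`). [folklore] -/
def layerAt (G : List Layer) (i : ℕ) : Layer := G.getD i ⟨fun _ _ => False, fun _ _ => 0⟩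

/-- Indexed form of a walk: `f i` is the row in column `i`. [folklore] -/
def IsWalkI (G : List Layer) (f : ℕ → ℕ) : Prop :=
  ∀ i < G.length, (layerAt G i).adj (f i) (f (i + 1))

/-- Cost of an indexed row sequence. [folklore] -/
def costI (G : List Layer) (f : ℕ → ℕ) : ℝ × ℝ :=
  ∑ i ∈ Finset.range G.length, (layerAt G i).w (f i) (f (i + 1))

/-- Layer `0` of a graph with a first layer. [folklore] -/
@[simp] theorem layerAt_cons_zero (l : Layer) (G : List Layer) : layerAt (l :: G) 0 = l := rfl

/-- Later layers of a graph with a first layer. [folklore] -/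
@[simp] theorem layerAt_cons_succ (l : Layer) (G : List Layer) (i : ℕ) :
    layerAt (l :: G) (i + 1) = layerAt G i := rfl

/-- `layerAt G i ∈ G` for `i < |G|`. [folklore] -/
theorem layerAt_mem (G : List Layer) {i : ℕ} (hi : i < G.length) : layerAt G i ∈ G := by
  rw [layerAt, List.getD_eq_getElem _ _ hi]
  exact List.getElem_mem hi

/-- `costI` only depends on the rows in columns `≤ |G|`. [folklore] -/
theorem costI_congr (G : List Layer) {f g : ℕ → ℕ} (h : ∀ i ≤ G.length, f i = g i) :
    costI G f = costI G g := by
  apply Finset.sum_congr rfl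
  intro i hi
  rw [Finset.mem_range] at hi
  rw [h i hi.le, h (i + 1) hi]

/-- Unfolding `IsWalkI` one layer. [folklore] -/
theorem isWalkI_cons (l : Layer) (G : List Layer) (f : ℕ → ℕ) :
    IsWalkI (l :: G) f ↔ l.adj (f 0) (f 1) ∧ IsWalkI G (fun i => f (i + 1)) := by
  constructor
  · intro h
    refine ⟨h 0 (by simp), fun i hi => ?_⟩
    exact h (i + 1) (by simpa using hi)
  · rintro ⟨h0, h1⟩ i hi
    cases i with
    | zero => simpa using h0
    | succ i =>
      have hi' : i < G.length := by simpa using hi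
      exact h1 i hi'

/-- Unfolding `costI` one layer. [folklore] -/
theorem costI_cons (l : Layer) (G : List Layer) (f : ℕ → ℕ) :
    costI (l :: G) f = l.w (f 0) (f 1) + costI G (fun i => f (i + 1)) := by
  simp only [costI, List.length_cons]
  rw [Finset.sum_range_succ']
  simp only [layerAt_cons_succ, layerAt_cons_zero, zero_add]
  rw [add_comm]

/-- From a walk (list form) to its indexed form. [folklore] -/
theorem isWalkI_of_isWalk : ∀ {G : List Layer} {b : ℕ} {p : List ℕ}, IsWalk G b p →
    IsWalkI G (fun i => (b :: p).getD i 0) ∧ cost G b p = costI G (fun i => (b :: p).getD i 0)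
  | [], b, [], _ => by simp [IsWalkI, costI]
  | [], _, _ :: _, h => h.elim
  | _ :: _, _, [], h => h.elim
  | l :: G, b, r :: rs, h => by
    obtain ⟨hadj, hrs⟩ := h
    obtain ⟨ih1, ih2⟩ := isWalkI_of_isWalk hrs
    refine ⟨(isWalkI_cons l G _).2 ⟨by simpa using hadj, ?_⟩, ?_⟩
    · simpa using ih1
    · rw [cost_cons_cons, costI_cons, ih2]
      simp

/-- From an indexed walk to its list form. [folklore] -/
theorem isWalk_of_isWalkI : ∀ (G : List Layer) (f : ℕ → ℕ), IsWalkI G f →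
    IsWalk G (f 0) (List.ofFn fun i : Fin G.length => f (i + 1)) ∧
      cost G (f 0) (List.ofFn fun i : Fin G.length => f (i + 1)) = costI G f
  | [], f, _ => by simp [costI]
  | l :: G, f, h => by
    obtain ⟨h0, h1⟩ := (isWalkI_cons l G f).1 h
    obtain ⟨ih1, ih2⟩ := isWalk_of_isWalkI G (fun i => f (i + 1)) h1
    simp only [List.length_cons, List.ofFn_succ, Fin.val_zero, zero_add, Fin.val_succ,
      isWalk_cons_cons, cost_cons_cons, costI_cons]
    refine ⟨⟨h0, ?_⟩, ?_⟩
    · simpa [add_assoc] using ih1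
    · rw [← ih2]

section Pattern

variable (G : List Layer) (W : ℕ)

/-- `a → b` is a graph arc between consecutive columns (indices `a = 1 + iW + x`,
`b = 1 + (i+1)W + y`, `x → y` an arc of layer `i`). [folklore] -/
def IsArc (a b : ℕ) : Prop :=
  1 ≤ a ∧ a < 1 + (G.length + 1) * W ∧ 1 ≤ b ∧ b < 1 + (G.length + 1) * W ∧
    (b - 1) / W = (a - 1) / W + 1 ∧ (layerAt G ((a - 1) / W)).adj ((a - 1) % W) ((b - 1) % W)

/-- The allowed pattern of index pairs: start arc, loops off `s = 0`, graph arcs, return arcs.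
[folklore] -/
def Pat (a b : ℕ) : Prop :=
  (a = 0 ∧ b = 1) ∨ (a = b ∧ a ≠ 0) ∨ IsArc G W a b ∨
    (1 ≤ a ∧ a < 1 + (G.length + 1) * W ∧ (a - 1) / W = G.length ∧ b = 0)

open Classical in
/-- Weight of a pair: the arc weight on graph arcs, `0` on all other pairs. [folklore] -/
def wt (a b : ℕ) : ℝ × ℝ :=
  if IsArc G W a b then (layerAt G ((a - 1) / W)).w ((a - 1) % W) ((b - 1) % W) else 0

open Classical in
/-- Weight with penalty `M` (in the constant coordinate) outside the pattern. [folklore] -/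
def wtPen (M : ℝ) (a b : ℕ) : ℝ × ℝ := if Pat G W a b then wt G W a b else (M, 0)

/-- No graph arc is a loop. [folklore] -/
theorem not_isArc_self (a : ℕ) : ¬ IsArc G W a a := fun h => by
  have := h.2.2.2.2.1; omega

/-- Loops weigh `0`. [folklore] -/
theorem wt_self (a : ℕ) : wt G W a a = 0 := by
  simp [wt, not_isArc_self]

/-- Pairs out of `s` weigh `0`. [folklore] -/
theorem wt_zero_left (b : ℕ) : wt G W 0 b = 0 := by
  have : ¬ IsArc G W 0 b := fun h => by have := h.1; omega
  simp [wt, this]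

/-- Pairs into `s` weigh `0`. [folklore] -/
theorem wt_zero_right (a : ℕ) : wt G W a 0 = 0 := by
  have : ¬ IsArc G W a 0 := fun h => by have := h.2.2.1; omega
  simp [wt, this]

/-- `π^{k+2} s = π (π^{k+1} s)`. [folklore] -/
theorem perm_pow_succ_apply {α : Type*} (π : Equiv.Perm α) (s : α) (k : ℕ) :
    (π ^ (k + 2)) s = π ((π ^ (k + 1)) s) := by
  rw [pow_succ', Equiv.Perm.mul_apply]

variable {G W}
variable {ν : ℕ} (π : Equiv.Perm (Fin ν)) (s : Fin ν) (hs : s.val = 0) (hW0 : 0 < W)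
  (hpat : ∀ u : Fin ν, Pat G W u.val (π u).val)
include hs hpat

/-- Inside the pattern, `π s` is the vertex `(0, 0)` (index `1`). [folklore] -/
theorem pat_start : (π s).val = 1 := by
  rcases hpat s with h | h | h | h
  · exact h.2
  · exact absurd hs h.2
  · have := h.1; omega
  · have := h.1; omega

/-- Inside the pattern, no point of the orbit of `s` is fixed. [folklore] -/
theorem noloop (k : ℕ) : π ((π ^ (k + 1)) s) ≠ (π ^ (k + 1)) s := by
  intro h
  have h1 : (π ^ (k + 1)) (π s) = (π ^ (k + 1)) s := by
    rw [← Equiv.Perm.mul_apply, ← pow_succ, pow_succ', Equiv.Perm.mul_apply]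
    exact h
  have h2 := (π ^ (k + 1)).injective h1
  have h3 := pat_start π s hs hpat
  rw [h2, hs] at h3
  exact absurd h3 (by norm_num)

include hW0

/-- The orbit of `s` climbs one column per step: `π^{k+1} s` lies in column `k` (`k ≤ T`).
[folklore] -/
theorem orbit_layer : ∀ k ≤ G.length,
    1 ≤ ((π ^ (k + 1)) s).val ∧ ((π ^ (k + 1)) s).val < 1 + (G.length + 1) * W ∧
      (((π ^ (k + 1)) s).val - 1) / W = k
  | 0, _ => by
    have h := pat_start π s hs hpat
    simp only [zero_add, pow_one] at h ⊢
    refine ⟨by omega, ?_, ?_⟩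
    · have : 1 ≤ (G.length + 1) * W := Nat.one_le_iff_ne_zero.2 (by positivity)
      omega
    · rw [h]; simp
  | k + 1, hk => by
    obtain ⟨ih1, ih2, ih3⟩ := orbit_layer k (by omega)
    rw [perm_pow_succ_apply]
    rcases hpat ((π ^ (k + 1)) s) with h | h | h | h
    · exact absurd h.1 (by omega)
    · exact absurd (Fin.ext h.1).symm (noloop π s hs hpat k)
    · obtain ⟨-, -, h3, h4, h5, -⟩ := h
      exact ⟨h3, h4, by rw [h5, ih3]⟩
    · exact absurd h.2.2.1 (by omega)

/-- Consecutive orbit points are joined by graph arcs. [folklore] -/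
theorem orbit_arc {k : ℕ} (hk : k < G.length) :
    IsArc G W ((π ^ (k + 1)) s).val ((π ^ (k + 2)) s).val := by
  obtain ⟨ih1, -, ih3⟩ := orbit_layer π s hs hW0 hpat k hk.le
  rw [perm_pow_succ_apply]
  rcases hpat ((π ^ (k + 1)) s) with h | h | h | h
  · exact absurd h.1 (by omega)
  · exact absurd (Fin.ext h.1).symm (noloop π s hs hpat k)
  · exact h
  · exact absurd h.2.2.1 (by omega)

/-- After the last column the orbit returns to `s`. [folklore] -/
theorem orbit_ret : (π ((π ^ (G.length + 1)) s)).val = 0 := by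
  obtain ⟨ih1, ih2, ih3⟩ := orbit_layer π s hs hW0 hpat G.length le_rfl
  rcases hpat ((π ^ (G.length + 1)) s) with h | h | h | h
  · exact absurd h.1 (by omega)
  · exact absurd (Fin.ext h.1).symm (noloop π s hs hpat G.length)
  · exfalso
    obtain ⟨-, -, -, h4, h5, -⟩ := h
    rw [ih3] at h5
    have : (π ((π ^ (G.length + 1)) s)).val - 1 < (G.length + 1) * W := by omega
    rw [← Nat.div_lt_iff_lt_mul hW0] at this
    omega
  · exact h.2.2.2

/-- Every index off the orbit of `s` is a fixed point. [folklore] -/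
theorem fixed_of_not_mem_orbit (u : Fin ν) (hu0 : u.val ≠ 0)
    (hu : ∀ k ≤ G.length, u ≠ (π ^ (k + 1)) s) : π u = u := by
  -- vertices: downward induction on the column; padding indices: directly
  by_cases hvert : u.val < 1 + (G.length + 1) * W
  · have hlay : (u.val - 1) / W ≤ G.length := by
      have : u.val - 1 < (G.length + 1) * W := by omega
      rw [← Nat.div_lt_iff_lt_mul hW0] at this
      omega
    -- induction on d = T - column
    suffices H : ∀ d, ∀ u : Fin ν, u.val ≠ 0 → u.val < 1 + (G.length + 1) * W →
        (u.val - 1) / W + d = G.length → (∀ k ≤ G.length, u ≠ (π ^ (k + 1)) s) → π u = u from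
      H (G.length - (u.val - 1) / W) u hu0 hvert (by omega) hu
    intro d
    induction d with
    | zero =>
      intro u hu0 hvert hcol hu
      rcases hpat u with h | h | h | h
      · exact absurd h.1 hu0
      · exact (Fin.ext h.1).symm
      · exfalso
        obtain ⟨-, -, -, h4, h5, -⟩ := h
        have : ((π u).val - 1) < (G.length + 1) * W := by omega
        rw [← Nat.div_lt_iff_lt_mul hW0] at this
        omega
      · exfalso
        have h1 := orbit_ret π s hs hW0 hpat
        have h2 : π u = π ((π ^ (G.length + 1)) s) := Fin.ext (by rw [h.2.2.2, h1])
        exact hu G.length le_rfl (π.injective h2)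
    | succ d ih =>
      intro u hu0 hvert hcol hu
      rcases hpat u with h | h | h | h
      · exact absurd h.1 hu0
      · exact (Fin.ext h.1).symm
      · exfalso
        obtain ⟨-, -, h3, h4, h5, -⟩ := h
        -- v := π u is a vertex in column (u.col + 1), off the orbit
        have hv : ∀ k ≤ G.length, π u ≠ (π ^ (k + 1)) s := by
          intro k hk heq
          obtain ⟨-, -, o3⟩ := orbit_layer π s hs hW0 hpat k hk
          have e1 : ((π u).val - 1) / W = k := by rw [heq]; exact o3
          have hkcol : k = (u.val - 1) / W + 1 := by omega
          cases k with
          | zero =>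
            generalize (u.val - 1) / W = q at hkcol
            omega
          | succ k =>
            -- π u = π (π^(k+1) s) ⇒ u on the orbit
            rw [perm_pow_succ_apply] at heq
            exact hu k (by omega) (π.injective heq)
        have hfix := ih (π u) (by omega) h4 (by omega) hv
        have := π.injective hfix
        -- then u = π u, contradicting the column shift
        rw [this] at h5
        omega
      · exfalso
        have h1 := orbit_ret π s hs hW0 hpat
        have h2 : π u = π ((π ^ (G.length + 1)) s) := Fin.ext (by rw [h.2.2.2, h1])
        exact hu G.length le_rfl (π.injective h2)
  · rcases hpat u with h | h | h | h
    · exact absurd h.1 hu0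
    · exact (Fin.ext h.1).symm
    · exact absurd h.2.1 hvert
    · exact absurd h.2.1 hvert

/-- The orbit points are distinct. [folklore] -/
theorem orbit_injOn : Set.InjOn (fun k => (π ^ (k + 1)) s) (Finset.range (G.length + 1) : Set ℕ) := by
  intro k hk k' hk' h
  simp only [Finset.coe_range, Set.mem_Iio] at hk hk'
  have h1 := (orbit_layer π s hs hW0 hpat k (by omega)).2.2
  have h2 := (orbit_layer π s hs hW0 hpat k' (by omega)).2.2
  simp only at h
  rw [← h1, ← h2, h]

/-- **Summing the weights over the pairs `(u, π u)` of a permutation inside the pattern gives the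
cost of the walk it traces.** [folklore] -/
theorem sum_wt_eq_costI [NeZero ν] :
    ∑ u : Fin ν, wt G W u.val (π u).val =
      costI G (fun k => (((π ^ (k + 1)) s).val - 1) % W) := by
  classical
  set C : Finset (Fin ν) := (Finset.range (G.length + 1)).image (fun k => (π ^ (k + 1)) s) with hC
  have hsub : C ⊆ Finset.univ := Finset.subset_univ _
  rw [← Finset.sum_subset hsub]
  · rw [hC, Finset.sum_image (orbit_injOn π s hs hW0 hpat), Finset.sum_range_succ, costI]
    have hlast : wt G W ((π ^ (G.length + 1)) s).val (π ((π ^ (G.length + 1)) s)).val = 0 := by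
      rw [orbit_ret π s hs hW0 hpat, wt_zero_right]
    rw [hlast, add_zero]
    apply Finset.sum_congr rfl
    intro k hk
    rw [Finset.mem_range] at hk
    have harc := orbit_arc π s hs hW0 hpat hk
    rw [← perm_pow_succ_apply]
    rw [wt, if_pos harc, (orbit_layer π s hs hW0 hpat k hk.le).2.2]
  · intro u _ huC
    by_cases hu0 : u.val = 0
    · have : u = s := Fin.ext (by rw [hu0, hs])
      rw [this, hs, wt_zero_left]
    · have hu : ∀ k ≤ G.length, u ≠ (π ^ (k + 1)) s := by
        intro k hk heq
        apply huC
        rw [hC, Finset.mem_image]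
        exact ⟨k, by simpa using Nat.lt_succ_of_le hk, heq.symm⟩
      rw [fixed_of_not_mem_orbit π s hs hW0 hpat u hu0 hu, wt_self]

/-- The traced row sequence is an indexed walk from row `0`. [folklore] -/
theorem isWalkI_orbit :
    IsWalkI G (fun k => (((π ^ (k + 1)) s).val - 1) % W) ∧ (((π ^ (0 + 1)) s).val - 1) % W = 0 := by
  refine ⟨fun k hk => ?_, ?_⟩
  · have harc := orbit_arc π s hs hW0 hpat hk
    have hcol := (orbit_layer π s hs hW0 hpat k hk.le).2.2
    have := harc.2.2.2.2.2
    rw [hcol] at this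
    exact this
  · have h := pat_start π s hs hpat
    simp [h]

end Pattern

section Realise

/-! #### Index arithmetic for the vertex code `1 + k·W + x` -/

/-- Column of the code `1 + kW + x`. [folklore] -/
theorem code_div {W : ℕ} (k : ℕ) {x : ℕ} (hx : x < W) : (1 + k * W + x - 1) / W = k := by
  rw [show 1 + k * W + x - 1 = x + k * W by omega, Nat.add_mul_div_right _ _ (by omega)]
  simp [Nat.div_eq_of_lt hx]

/-- Row of the code `1 + kW + x`. [folklore] -/
theorem code_mod {W : ℕ} (k : ℕ) {x : ℕ} (hx : x < W) : (1 + k * W + x - 1) % W = x := by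
  rw [show 1 + k * W + x - 1 = x + k * W by omega, Nat.add_mul_mod_self_right, Nat.mod_eq_of_lt hx]

/-- Codes of vertices in columns `≤ T` are `< 1 + (T+1)W`. [folklore] -/
theorem code_lt {W T k x : ℕ} (hk : k ≤ T) (hx : x < W) : 1 + k * W + x < 1 + (T + 1) * W := by
  have h2 : (k + 1) * W = k * W + W := by ring
  have h3 : (k + 1) * W ≤ (T + 1) * W := Nat.mul_le_mul_right _ (by omega)
  omega

variable {ν : ℕ} (hν0 : 0 < ν)

/-- The extra vertex `s` (index `0`). [folklore] -/
def sVtx : Fin ν := ⟨0, hν0⟩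

/-- The vertex `(k, x)` as an index (clamped; only used in range). [folklore] -/
def vtx (W k x : ℕ) : Fin ν := ⟨min (1 + k * W + x) (ν - 1), by omega⟩

/-- Value of the vertex code in range. [folklore] -/
theorem vtx_val {W T k x : ℕ} (hν : 1 + (T + 1) * W ≤ ν) (hk : k ≤ T) (hx : x < W) :
    (vtx hν0 W k x).val = 1 + k * W + x := by
  have := code_lt hk hx
  simp only [vtx]
  omega

/-- The cycle `s, (0, f 0), (1, f 1), …, (T, f T)` as a list of indices. [folklore] -/
def orbitList (W T : ℕ) (f : ℕ → ℕ) : List (Fin ν) :=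
  sVtx hν0 :: List.ofFn (fun k : Fin (T + 1) => vtx hν0 W k (f k))

/-- `orbitList` has `T + 2` entries. [folklore] -/
theorem orbitList_length (W T : ℕ) (f : ℕ → ℕ) : (orbitList hν0 W T f).length = T + 2 := by
  simp [orbitList]

/-- `orbitList` starts at `s`. [folklore] -/
theorem orbitList_getElem_zero (W T : ℕ) (f : ℕ → ℕ) (h : 0 < (orbitList hν0 W T f).length) :
    (orbitList hν0 W T f)[0] = sVtx hν0 := by
  simp [orbitList]

/-- The later entries of `orbitList`. [folklore] -/
theorem orbitList_getElem_succ (W T : ℕ) (f : ℕ → ℕ) {k : ℕ} (_hk : k ≤ T)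
    (h : k + 1 < (orbitList hν0 W T f).length) :
    (orbitList hν0 W T f)[k + 1] = vtx hν0 W k (f k) := by
  simp only [orbitList, List.getElem_cons_succ, List.getElem_ofFn]

/-- Re-indexing a list access along an equality of indices. [folklore] -/
theorem getElem_idx_eq {α : Type*} (l : List α) {i j : ℕ} (h : i = j) (hi : i < l.length) :
    l[i] = l[j]'(h ▸ hi) := by
  subst h; rfl

/-- `orbitList` has no repeated entries (rows in range). [folklore] -/
theorem orbitList_nodup {W T : ℕ} {f : ℕ → ℕ} (hν : 1 + (T + 1) * W ≤ ν)
    (hf : ∀ k ≤ T, f k < W) : (orbitList hν0 W T f).Nodup := by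
  rw [orbitList, List.nodup_cons, List.nodup_ofFn]
  constructor
  · rw [List.mem_ofFn]
    rintro ⟨k, hk⟩
    have h1 := vtx_val hν0 hν (Nat.le_of_lt_succ k.isLt) (hf k (Nat.le_of_lt_succ k.isLt))
    rw [hk] at h1
    simp only [sVtx] at h1
    omega
  · intro k k' h
    have h' : vtx hν0 W k (f k) = vtx hν0 W k' (f k') := h
    have h1 := vtx_val hν0 hν (Nat.le_of_lt_succ k.isLt) (hf k (Nat.le_of_lt_succ k.isLt))
    have h2 := vtx_val hν0 hν (Nat.le_of_lt_succ k'.isLt) (hf k' (Nat.le_of_lt_succ k'.isLt))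
    have h3 : 1 + (k : ℕ) * W + f k = 1 + (k' : ℕ) * W + f k' := by rw [← h1, ← h2, h']
    have h4 := code_div (k : ℕ) (hf k (Nat.le_of_lt_succ k.isLt))
    have h5 := code_div (k' : ℕ) (hf k' (Nat.le_of_lt_succ k'.isLt))
    rw [h3] at h4
    exact Fin.ext (h4.symm.trans h5)

/-- The cyclic permutation along `orbitList` lies inside the pattern. [folklore] -/
theorem pat_formPerm {G : List Layer} {W : ℕ} (hν : 1 + (G.length + 1) * W ≤ ν)
    {f : ℕ → ℕ} (hf : ∀ k ≤ G.length, f k < W) (hf0 : f 0 = 0) (hwalk : IsWalkI G f) :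
    ∀ u : Fin ν, Pat G W u.val ((orbitList hν0 W G.length f).formPerm u).val := by
  classical
  have hnd := orbitList_nodup hν0 hν hf
  have hlen := orbitList_length hν0 W G.length f
  intro u
  by_cases hu : u ∈ orbitList hν0 W G.length f
  · obtain ⟨i, hi, rfl⟩ := List.mem_iff_getElem.1 hu
    rw [List.formPerm_apply_getElem _ hnd i hi]
    have hi' : i < G.length + 2 := by rw [← hlen]; exact hi
    rcases Nat.eq_zero_or_pos i with rfl | hipos
    · -- the start arc `s → (0, 0)`
      left
      have hidx : (0 + 1) % (orbitList hν0 W G.length f).length = 0 + 1 := by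
        rw [hlen]; exact Nat.mod_eq_of_lt (by omega)
      rw [getElem_idx_eq _ hidx, orbitList_getElem_zero,
        orbitList_getElem_succ hν0 _ _ _ (Nat.zero_le _)]
      refine ⟨rfl, ?_⟩
      rw [vtx_val hν0 hν (Nat.zero_le _) (hf 0 (Nat.zero_le _)), hf0]
      ring
    · obtain ⟨k, rfl⟩ : ∃ k, i = k + 1 := ⟨i - 1, by omega⟩
      rw [orbitList_getElem_succ hν0 _ _ _ (by omega)]
      rw [vtx_val hν0 hν (by omega) (hf k (by omega))]
      by_cases hkT : k < G.length
      · -- a graph arc `(k, f k) → (k+1, f (k+1))`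
        right; right; left
        have hidx : (k + 1 + 1) % (orbitList hν0 W G.length f).length = (k + 1) + 1 := by
          rw [hlen]; exact Nat.mod_eq_of_lt (by omega)
        rw [getElem_idx_eq _ hidx, orbitList_getElem_succ hν0 _ _ _ (by omega),
          vtx_val hν0 hν (by omega) (hf (k + 1) (by omega))]
        refine ⟨by omega, code_lt hkT.le (hf k hkT.le), by omega,
          code_lt (by omega) (hf (k + 1) (by omega)), ?_, ?_⟩
        · rw [code_div _ (hf k hkT.le), code_div _ (hf (k + 1) (by omega))]
        · rw [code_div _ (hf k hkT.le), code_mod _ (hf k hkT.le), code_mod _ (hf (k + 1) (by omega))]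
          exact hwalk k hkT
      · -- the return arc `(T, f T) → s`
        have hk : k = G.length := by omega
        subst hk
        right; right; right
        have hidx : (G.length + 1 + 1) % (orbitList hν0 W G.length f).length = 0 := by
          rw [hlen, show G.length + 1 + 1 = G.length + 2 by ring, Nat.mod_self]
        rw [getElem_idx_eq _ hidx, orbitList_getElem_zero]
        exact ⟨by omega, code_lt le_rfl (hf _ le_rfl), code_div _ (hf _ le_rfl), rfl⟩
  · rw [List.formPerm_apply_of_notMem hu]
    right; left
    refine ⟨rfl, fun h0 => hu ?_⟩
    have : u = sVtx hν0 := Fin.ext h0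
    rw [this, orbitList]
    exact List.mem_cons_self

/-- Powers of the cyclic permutation walk along `orbitList`. [folklore] -/
theorem formPerm_pow_sVtx {W T : ℕ} {f : ℕ → ℕ} (hν : 1 + (T + 1) * W ≤ ν)
    (hf : ∀ k ≤ T, f k < W) :
    ∀ k ≤ T, (((orbitList hν0 W T f).formPerm ^ (k + 1)) (sVtx hν0)).val = 1 + k * W + f k := by
  classical
  have hnd := orbitList_nodup hν0 hν hf
  have hlen := orbitList_length hν0 W T f
  -- `π^(k+1) s = l[k+1]`
  have key : ∀ (k : ℕ) (hk : k ≤ T), ((orbitList hν0 W T f).formPerm ^ (k + 1)) (sVtx hν0) =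
      (orbitList hν0 W T f)[k + 1]'(by rw [hlen]; omega) := by
    intro k
    induction k with
    | zero =>
      intro _
      have h0 := List.formPerm_apply_getElem _ hnd 0 (by rw [hlen]; omega)
      simp only [pow_one, zero_add]
      rw [orbitList_getElem_zero] at h0
      rw [h0]
      congr 1
      rw [hlen]; exact Nat.mod_eq_of_lt (by omega)
    | succ k ih =>
      intro hk
      rw [perm_pow_succ_apply, ih (by omega), List.formPerm_apply_getElem _ hnd]
      congr 1
      rw [hlen]; exact Nat.mod_eq_of_lt (by omega)
  intro k hk
  rw [key k hk, orbitList_getElem_succ hν0 _ _ _ hk, vtx_val hν0 hν hk (hf k hk)]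

/-! #### The linear map reading a weight table off a permutation matrix -/

/-- `X ↦ (∑ X_{ij} · v(j, i).1, ∑ X_{ij} · v(j, i).2)`: on the permutation matrix of `ρ` (entry
`(i, j) = 1` iff `ρ j = i`) this is `∑_u v(u, ρ u)`. [folklore] -/
def Lmap (v : Fin ν → Fin ν → ℝ × ℝ) : (Fin ν × Fin ν → ℝ) →ₗ[ℝ] (Fin 2 → ℝ) where
  toFun X i := ∑ p : Fin ν × Fin ν, X p * (if i = 0 then (v p.2 p.1).1 else (v p.2 p.1).2)
  map_add' X Y := by
    ext i
    simp only [Pi.add_apply, add_mul, Finset.sum_add_distrib]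
  map_smul' c X := by
    ext i
    simp only [Pi.smul_apply, smul_eq_mul, RingHom.id_apply, Finset.mul_sum, mul_assoc]

/-- `Lmap v` on the permutation matrix of `ρ`, coordinatewise. [folklore] -/
theorem Lmap_perm_apply (v : Fin ν → Fin ν → ℝ × ℝ) (ρ : Equiv.Perm (Fin ν)) (i : Fin 2) :
    Lmap v (fun ij : Fin ν × Fin ν => if ρ ij.2 = ij.1 then (1 : ℝ) else 0) i =
      if i = 0 then (∑ u, v u (ρ u)).1 else (∑ u, v u (ρ u)).2 := by
  classical
  simp only [Lmap, LinearMap.coe_mk, AddHom.coe_mk, ite_mul, one_mul, zero_mul]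
  rw [Fintype.sum_prod_type_right]
  simp only [Finset.sum_ite_eq, Finset.mem_univ, if_true]
  split_ifs
  · rw [Prod.fst_sum]
  · rw [Prod.snd_sum]

/-- `Lmap v` on the permutation matrix of `ρ` is `∑_u v(u, ρ u)`. [folklore] -/
theorem Lmap_perm_eq (v : Fin ν → Fin ν → ℝ × ℝ) (ρ : Equiv.Perm (Fin ν)) :
    Lmap v (fun ij : Fin ν × Fin ν => if ρ ij.2 = ij.1 then (1 : ℝ) else 0) =
      ![(∑ u, v u (ρ u)).1, (∑ u, v u (ρ u)).2] := by
  ext i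
  rw [Lmap_perm_apply]
  fin_cases i <;> simp

/-! #### The penalty bound -/

/-- A crude bound for all arc weights evaluated at `|t| ≤ Λ`. [folklore] -/
def wBound (G : List Layer) (W : ℕ) (Λ : ℝ) : ℝ :=
  ∑ i ∈ Finset.range G.length, ∑ x ∈ Finset.range W, ∑ y ∈ Finset.range W,
    (|((layerAt G i).w x y).1| + |Λ| * |((layerAt G i).w x y).2|)

/-- `wBound ≥ 0`. [folklore] -/
theorem wBound_nonneg (G : List Layer) (W : ℕ) (Λ : ℝ) : 0 ≤ wBound G W Λ := by
  unfold wBound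
  positivity

/-- `|c(t)| ≤ |c.1| + |Λ| |c.2|` for `|t| ≤ Λ`. [folklore] -/
theorem abs_eval_le {c : ℝ × ℝ} {t Λ : ℝ} (ht : |t| ≤ Λ) : |eval c t| ≤ |c.1| + |Λ| * |c.2| := by
  unfold eval
  have h1 : |t| * |c.2| ≤ |Λ| * |c.2| :=
    mul_le_mul_of_nonneg_right (ht.trans (le_abs_self Λ)) (abs_nonneg _)
  calc |c.1 + t * c.2| ≤ |c.1| + |t * c.2| := abs_add_le _ _
    _ = |c.1| + |t| * |c.2| := by rw [abs_mul]
    _ ≤ |c.1| + |Λ| * |c.2| := by linarith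

/-- Every pattern weight is bounded by `wBound` at `|t| ≤ Λ`. [folklore] -/
theorem abs_eval_wt_le {G : List Layer} {W : ℕ} (hW0 : 0 < W) (a b : ℕ) {t Λ : ℝ}
    (ht : |t| ≤ Λ) : |eval (wt G W a b) t| ≤ wBound G W Λ := by
  unfold wt
  split_ifs with harc
  · obtain ⟨-, -, -, h4, h5, -⟩ := harc
    have hi : (a - 1) / W < G.length := by
      have hWle : W ≤ (G.length + 1) * W := Nat.le_mul_of_pos_left W (by omega)
      have : (b - 1) / W < G.length + 1 := by
        rw [Nat.div_lt_iff_lt_mul hW0]; omega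
      omega
    have hx : (a - 1) % W < W := Nat.mod_lt _ hW0
    have hy : (b - 1) % W < W := Nat.mod_lt _ hW0
    refine (abs_eval_le ht).trans ?_
    unfold wBound
    refine le_trans ?_ (Finset.single_le_sum (f := fun i => ∑ x ∈ Finset.range W,
      ∑ y ∈ Finset.range W, (|((layerAt G i).w x y).1| + |Λ| * |((layerAt G i).w x y).2|))
      (fun i _ => by positivity) (Finset.mem_range.2 hi))
    refine le_trans ?_ (Finset.single_le_sum (f := fun x => ∑ y ∈ Finset.range W,
      (|((layerAt G ((a - 1) / W)).w x y).1| + |Λ| * |((layerAt G ((a - 1) / W)).w x y).2|))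
      (fun i _ => by positivity) (Finset.mem_range.2 hx))
    exact Finset.single_le_sum (f := fun y =>
      (|((layerAt G ((a - 1) / W)).w ((a - 1) % W) y).1| +
        |Λ| * |((layerAt G ((a - 1) / W)).w ((a - 1) % W) y).2|))
      (fun i _ => by positivity) (Finset.mem_range.2 hy)
  · simp only [eval_zero, abs_zero]
    exact wBound_nonneg G W Λ

/-- A permutation leaving the pattern pays the penalty. [folklore] -/
theorem penalty_bound {G : List Layer} {W : ℕ} (hW0 : 0 < W) (Λ M₀ : ℝ)
    (ρ : Equiv.Perm (Fin ν)) {u₀ : Fin ν} (hu₀ : ¬ Pat G W u₀.val (ρ u₀).val) {t : ℝ}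
    (ht : |t| ≤ Λ) :
    M₀ ≤ ∑ u : Fin ν, eval (wtPen G W (|M₀| + ν * wBound G W Λ) u.val (ρ u).val) t := by
  classical
  set R := wBound G W Λ with hR
  have hR0 : 0 ≤ R := wBound_nonneg G W Λ
  have hterm : ∀ u : Fin ν, -R ≤ eval (wtPen G W (|M₀| + ν * R) u.val (ρ u).val) t := by
    intro u
    unfold wtPen
    split_ifs
    · exact (neg_le_neg (abs_eval_wt_le hW0 _ _ ht)).trans (neg_abs_le _)
    · simp only [eval, mul_zero, add_zero]
      have : 0 ≤ (ν : ℝ) * R := by positivity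
      linarith [abs_nonneg M₀]
  have h0 : eval (wtPen G W (|M₀| + ν * R) u₀.val (ρ u₀).val) t = |M₀| + ν * R := by
    unfold wtPen
    rw [if_neg hu₀]
    simp [eval]
  rw [← Finset.add_sum_erase Finset.univ _ (Finset.mem_univ u₀), h0]
  have hcard : (Finset.univ.erase u₀).card = ν - 1 := by
    rw [Finset.card_erase_of_mem (Finset.mem_univ u₀), Finset.card_univ, Fintype.card_fin]
  have h1 := Finset.card_nsmul_le_sum (Finset.univ.erase u₀) _ (-R) (fun u _ => hterm u)
  rw [hcard, nsmul_eq_mul] at h1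
  have hν1 : ((ν - 1 : ℕ) : ℝ) ≤ ν := by exact_mod_cast Nat.sub_le ν 1
  have h2 : -((ν : ℝ) * R) ≤ ((ν - 1 : ℕ) : ℝ) * (-R) := by nlinarith
  linarith [le_abs_self M₀]

/-! #### Assembly -/

/-- **Walks as permutation matrices.**  For a layered graph `G` on rows `< W` and
`ν ≥ 1 + (|G| + 1)·W` there is a linear map `L : ℝ^{ν×ν} → ℝ²` such that every walk from row `0`
has its cost pair realised as `L X` for some permutation matrix `X`, and every permutation matrix
either realises the cost of such a walk or is very expensive at every bounded parameter.
[cite: MulmuleyShah2001, Cor. 1.1] -/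
theorem embed (G : List Layer) (W : ℕ) (hW0 : 0 < W)
    (hW : ∀ l ∈ G, ∀ x y, l.adj x y → x < W ∧ y < W) (hν : 1 + (G.length + 1) * W ≤ ν)
    (Λ M₀ : ℝ) :
    ∃ L : (Fin ν × Fin ν → ℝ) →ₗ[ℝ] (Fin 2 → ℝ),
      (∀ p, IsWalk G 0 p → ∃ X ∈ permMatrixPoints ν, L X = ![(cost G 0 p).1, (cost G 0 p).2]) ∧
      (∀ X ∈ permMatrixPoints ν,
        (∃ p, IsWalk G 0 p ∧ L X = ![(cost G 0 p).1, (cost G 0 p).2]) ∨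
        ∀ t : ℝ, |t| ≤ Λ → M₀ ≤ L X 0 + t * L X 1) := by
  classical
  have hν0' : 0 < ν := by
    have : 1 ≤ 1 + (G.length + 1) * W := by omega
    omega
  haveI : NeZero ν := ⟨by omega⟩
  set M : ℝ := |M₀| + ν * wBound G W Λ with hM
  set v : Fin ν → Fin ν → ℝ × ℝ := fun a b => wtPen G W M a.val b.val with hv
  refine ⟨Lmap v, ?_, ?_⟩
  · -- walks are realised
    intro p hp
    obtain ⟨hfI, hcost⟩ := isWalkI_of_isWalk hp
    set f : ℕ → ℕ := fun i => (0 :: p).getD i 0 with hf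
    have hf0 : f 0 = 0 := by simp [hf]
    have hfW : ∀ k ≤ G.length, f k < W := by
      intro k hk
      cases k with
      | zero => rw [hf0]; exact hW0
      | succ k =>
        have hk' : k < G.length := by omega
        exact (hW _ (layerAt_mem G hk') _ _ (hfI k hk')).2
    set π := (orbitList hν0' W G.length f).formPerm with hπ
    have hpat : ∀ u : Fin ν, Pat G W u.val (π u).val := pat_formPerm hν0' hν hfW hf0 hfI
    refine ⟨fun ij => if π ij.2 = ij.1 then 1 else 0, ⟨π, rfl⟩, ?_⟩
    rw [Lmap_perm_eq, hcost]
    have hall : ∑ u, v u (π u) = ∑ u : Fin ν, wt G W u.val (π u).val := by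
      apply Finset.sum_congr rfl
      intro u _
      simp only [hv, wtPen]
      rw [if_pos (hpat u)]
    have hsum := sum_wt_eq_costI π (sVtx hν0') rfl hW0 hpat
    have hrows : ∀ k ≤ G.length, (((π ^ (k + 1)) (sVtx hν0')).val - 1) % W = f k := by
      intro k hk
      rw [hπ, formPerm_pow_sVtx hν0' hν hfW k hk, code_mod _ (hfW k hk)]
    rw [hall, hsum, costI_congr G hrows]
  · -- every permutation matrix: a walk, or expensive
    rintro X ⟨ρ, rfl⟩
    by_cases hall : ∀ u : Fin ν, Pat G W u.val (ρ u).val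
    · left
      obtain ⟨hwI, hrow0⟩ := isWalkI_orbit ρ (sVtx hν0') rfl hW0 hall
      obtain ⟨hw, hc⟩ := isWalk_of_isWalkI G _ hwI
      simp only [zero_add, pow_one] at hrow0 hw hc
      rw [hrow0] at hw hc
      refine ⟨_, hw, ?_⟩
      rw [Lmap_perm_eq, hc]
      have hv' : ∑ u, v u (ρ u) = ∑ u : Fin ν, wt G W u.val (ρ u).val := by
        apply Finset.sum_congr rfl
        intro u _
        simp only [hv, wtPen]
        rw [if_pos (hall u)]
      rw [hv', sum_wt_eq_costI ρ (sVtx hν0') rfl hW0 hall]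
    · right
      push Not at hall
      obtain ⟨u₀, hu₀⟩ := hall
      intro t ht
      rw [Lmap_perm_apply, Lmap_perm_apply]
      simp only [if_true, Fin.one_eq_zero_iff, OfNat.ofNat_ne_one, if_false]
      rw [Prod.fst_sum, Prod.snd_sum, Finset.mul_sum, ← Finset.sum_add_distrib]
      have := penalty_bound hW0 Λ M₀ ρ hu₀ ht
      simpa [eval, hv, hM] using this

end Realise

/-! ### Section G: assembly — `σ(DS_ν) ≥ 2^{Ω(log² ν)}` -/

/-- **The core count.** For `n ≥ 2` and `ν ≥ 1 + (|G(1,0,m)| + 1)(1 + m n)`, some linear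
`L : ℝ^{ν×ν} → ℝ²` projects the `ν × ν` permutation matrices onto a polygon with at least `n^m`
vertices: the `n^m` dedicated walks `P_{0j}` of `G(1, 0, m)` give `n^m` distinct cost pairs, each
the unique minimiser of `(y₀, y₁) ↦ y₀ + λ_j y₁` over the image (GR19 Theorem 1 / Lemma 26 with
`B = 1`, `D = 0`, read through the embedding of Section F).
[cite: HrubesYehudayoff2021, Prop. 23] -/
theorem core {n m ν : ℕ} (hn : 2 ≤ n) (hν : 1 + (len m + 1) * (1 + m * n) ≤ ν) :
    ∃ L : (Fin ν × Fin ν → ℝ) →ₗ[ℝ] (Fin 2 → ℝ), n ^ m ≤ birkhoffShadowVertexCount L := by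
  classical
  have hn1 : 1 ≤ n := by omega
  have hnR : (2 : ℝ) ≤ n := by exact_mod_cast hn
  have hN1 : (1 : ℝ) ≤ (n : ℝ) ^ 2 := by nlinarith
  have hW0 : 0 < 1 + m * n := by omega
  have hW : ∀ l ∈ graph n m 1 0, ∀ x y, l.adj x y → x < 1 + m * n ∧ y < 1 + m * n :=
    fun l hl x y h => adj_bound n m 1 0 l hl x y h
  have hν' : 1 + ((graph n m 1 0).length + 1) * (1 + m * n) ≤ ν := by
    rw [length_graph]; exact hν
  -- parameters `λ_j = α(m, j) + 1`, costs `c_j`, bounds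
  set lam : ℕ → ℝ := fun j => (alpha n m j : ℝ) + 1 with hlam
  set c : ℕ → ℝ × ℝ := fun j => cost (graph n m 1 0) 0 (path n m 0 j) with hc
  set M₀ : ℝ := 1 + ∑ j ∈ Finset.range (n ^ m), |eval (c j) (lam j)| with hM₀
  obtain ⟨L, hL1, hL2⟩ := embed (graph n m 1 0) (1 + m * n) hW0 hW hν' (((n : ℝ) ^ 2) ^ (m + 1)) M₀
  refine ⟨L, ?_⟩
  have hwalk : ∀ j < n ^ m, IsWalk (graph n m 1 0) 0 (path n m 0 j) :=
    fun j hj => isWalk_path hn1 m 1 0 0 j (by omega) hj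
  have hlam2 : ∀ j, lam j ≤ (alpha n m j : ℝ) + (n : ℝ) ^ 2 - 1 := by
    intro j
    simp only [hlam]
    nlinarith
  have hmain : ∀ j < n ^ m, ∀ q, IsWalk (graph n m 1 0) 0 q → q ≠ path n m 0 j →
      eval (c j) (lam j) + 1 ≤ eval (cost (graph n m 1 0) 0 q) (lam j) :=
    fun j hj q hq hne => main_ineq hn m 1 0 0 j (lam j) q (by simp) (by omega) hj le_rfl (hlam2 j)
      hq hne
  have hlamΛ : ∀ j, |lam j| ≤ ((n : ℝ) ^ 2) ^ (m + 1) := by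
    intro j
    have h0 : 0 ≤ lam j := by simp only [hlam]; positivity
    rw [abs_of_nonneg h0]
    have := alpha_bound_real hn m j
    simp only [hlam]
    linarith
  have hM₀gt : ∀ j < n ^ m, eval (c j) (lam j) < M₀ := by
    intro j hj
    have h1 := Finset.single_le_sum (f := fun j => |eval (c j) (lam j)|) (fun i _ => abs_nonneg _)
      (Finset.mem_range.2 hj)
    have h2 := le_abs_self (eval (c j) (lam j))
    simp only [hM₀]
    linarith
  -- the points `z_j`
  set z : ℕ → (Fin 2 → ℝ) := fun j => ![(c j).1, (c j).2] with hz
  have hzS : ∀ j < n ^ m, z j ∈ L '' permMatrixPoints ν := by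
    intro j hj
    obtain ⟨X, hX, hLX⟩ := hL1 _ (hwalk j hj)
    exact ⟨X, hX, hLX⟩
  have hz0 : ∀ j, z j 0 + lam j * z j 1 = eval (c j) (lam j) := by
    intro j; simp [hz, eval]
  -- strict minimality of `z_j` for `y ↦ y₀ + λ_j y₁` over the image
  have hstrict : ∀ j < n ^ m, ∀ s ∈ L '' permMatrixPoints ν, s ≠ z j →
      eval (c j) (lam j) < s 0 + lam j * s 1 := by
    intro j hj s hs hne
    obtain ⟨X, hX, rfl⟩ := hs
    rcases hL2 X hX with ⟨q, hq, hLX⟩ | hpen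
    · have hqne : q ≠ path n m 0 j := by
        rintro rfl
        exact hne (by rw [hLX])
      have h1 := hmain j hj q hq hqne
      rw [hLX]
      simp only [eval, Matrix.cons_val_zero, Matrix.cons_val_one] at h1 ⊢
      linarith
    · have := hpen (lam j) (hlamΛ j)
      linarith [hM₀gt j hj]
  -- hence every `z_j` is a vertex
  have hext : ∀ j < n ^ m, z j ∈ (convexHull ℝ (L '' permMatrixPoints ν)).extremePoints ℝ := by
    intro j hj
    apply mem_extremePoints_convexHull_of_forall_lt
      (-(ContinuousLinearMap.proj 0 + lam j • ContinuousLinearMap.proj 1)) (hzS j hj)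
    intro s hs hne
    have h1 := hstrict j hj s hs hne
    have h2 := hz0 j
    have e : ∀ y : Fin 2 → ℝ,
        (-(ContinuousLinearMap.proj 0 + lam j • ContinuousLinearMap.proj 1) :
          (Fin 2 → ℝ) →L[ℝ] ℝ) y = -(y 0 + lam j * y 1) := fun y => by
      simp
    rw [e, e]
    linarith
  -- and they are pairwise distinct
  have hinj : ∀ j < n ^ m, ∀ j' < n ^ m, z j = z j' → j = j' := by
    intro j hj j' hj' hzz
    by_contra hne
    have hP : path n m 0 j' ≠ path n m 0 j := fun h =>
      hne (path_injective hn1 m 0 j j' hj hj' h.symm)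
    have h1 := hmain j hj _ (hwalk j' hj') hP
    have hcc : c j' = c j := by
      have e0 := congrFun hzz 0
      have e1 := congrFun hzz 1
      simp only [hz, Matrix.cons_val_zero, Matrix.cons_val_one] at e0 e1
      exact Prod.ext e0.symm e1.symm
    have h2 : cost (graph n m 1 0) 0 (path n m 0 j') = c j := hcc
    rw [h2] at h1
    linarith
  -- count
  have hfin : ((convexHull ℝ (L '' permMatrixPoints ν)).extremePoints ℝ).Finite := by
    apply Set.Finite.subset _ extremePoints_convexHull_subset
    apply Set.Finite.image
    have : permMatrixPoints ν = Set.range (fun ρ : Equiv.Perm (Fin ν) =>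
        fun ij : Fin ν × Fin ν => if ρ ij.2 = ij.1 then (1 : ℝ) else 0) := by
      ext x
      simp only [permMatrixPoints, Set.mem_setOf_eq, Set.mem_range]
      constructor
      · rintro ⟨ρ, rfl⟩; exact ⟨ρ, rfl⟩
      · rintro ⟨ρ, rfl⟩; exact ⟨ρ, rfl⟩
    rw [this]
    exact Set.finite_range _
  exact le_ncard_of_injOn_range hfin (n ^ m) z hext hinj

/-- Size bookkeeping: with `m = ⌊log₂ ν⌋ / 5` and `n = 2^m`, the graph `G(1, 0, m)` fits into
`ν × ν` matrices once `ν ≥ 1024`. [cite: HrubesYehudayoff2021, Prop. 23] -/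
theorem size_ok {ν : ℕ} (hν : 1024 ≤ ν) :
    1 + (len (Nat.log 2 ν / 5) + 1) * (1 + Nat.log 2 ν / 5 * 2 ^ (Nat.log 2 ν / 5)) ≤ ν := by
  set Lg := Nat.log 2 ν with hLg
  set m := Lg / 5 with hm
  have hLg10 : 10 ≤ Lg := Nat.le_log_of_pow_le (by norm_num) (by norm_num; omega)
  have h1 : len m + 1 ≤ 3 ^ m := by have := two_mul_len_add_one m; omega
  have h2 : 1 + m * 2 ^ m ≤ 4 ^ m := by
    have h3 : m < 2 ^ m := Nat.lt_two_pow_self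
    have h4 : (4 : ℕ) ^ m = 2 ^ m * 2 ^ m := by rw [← mul_pow]; norm_num
    rw [h4]
    have h5 : (m + 1) * 2 ^ m ≤ 2 ^ m * 2 ^ m := Nat.mul_le_mul_right _ h3
    have h6 : 1 ≤ 2 ^ m := Nat.one_le_two_pow
    nlinarith
  have h4 : (len m + 1) * (1 + m * 2 ^ m) ≤ 3 ^ m * 4 ^ m := Nat.mul_le_mul h1 h2
  have h5 : 3 ^ m * 4 ^ m ≤ 16 ^ m := by
    rw [← mul_pow]; exact Nat.pow_le_pow_left (by norm_num) m
  have h6 : (16 : ℕ) ^ m = 2 ^ (4 * m) := by rw [pow_mul]; norm_num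
  have h7 : 4 * m ≤ Lg - 1 := by omega
  have h8 : 2 ^ (4 * m) ≤ 2 ^ (Lg - 1) := Nat.pow_le_pow_right (by norm_num) h7
  have h9 : 2 ^ Lg ≤ ν := Nat.pow_log_le_self 2 (by omega)
  have h10 : 2 ^ (Lg - 1) * 2 = 2 ^ Lg := by
    rw [← pow_succ]; congr 1; omega
  omega

end BirkhoffShadowLower

open BirkhoffShadowLower in
/-- **Hrubeš–Yehudayoff 2021, Proposition 23 (lower half): `σ(DS_n) ≥ 2^{Ω(log² n)}`.**
Discharge of the named fact `HrubesYehudayoff2021_prop23_lower`, with `c = 1/100` and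
`n₀ = 1024`: for `ν ≥ 1024` put `m = ⌊log₂ ν⌋ / 5`, `n = 2^m`; the Carstensen–Mulmuley–Shah
graph `G(1, 0, m)` (Gajjar–Radhakrishnan's Lemma 26) has `≤ 3^m` columns of `≤ 1 + m·2^m` rows,
fits into `S_ν`, and yields `n^m = 2^{m²} ≥ 2^{(log₂ ν)²/100}` shadow vertices.
[cite: HrubesYehudayoff2021, Prop. 23; proof via GajjarRadhakrishnan2019, Thm 1 & Lemma 26,
after Carstensen 1983 and Mulmuley–Shah 2001] -/
theorem HrubesYehudayoff2021_prop23_lower_holds : HrubesYehudayoff2021_prop23_lower := by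
  refine ⟨1 / 100, by norm_num, 1024, fun ν hν => ?_⟩
  set Lg := Nat.log 2 ν with hLg
  set m := Lg / 5 with hm
  have hLg10 : 10 ≤ Lg := Nat.le_log_of_pow_le (by norm_num) (by norm_num; omega)
  have hm2 : 2 ≤ m := by omega
  have hn2 : 2 ≤ 2 ^ m := by
    calc 2 = 2 ^ 1 := by norm_num
      _ ≤ 2 ^ m := Nat.pow_le_pow_right (by norm_num) (by omega)
  obtain ⟨L, hL⟩ := BirkhoffShadowLower.core (n := 2 ^ m) (m := m) hn2 (size_ok hν)
  refine ⟨L, ?_⟩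
  have hcount : (((2 ^ m) ^ m : ℕ) : ℝ) ≤ (birkhoffShadowVertexCount L : ℝ) := by
    exact_mod_cast hL
  have hν0 : (0 : ℝ) < ν := by
    have : (1 : ℝ) ≤ ν := by exact_mod_cast (show 1 ≤ ν by omega)
    linarith
  have hlogb : Real.logb 2 ν < Lg + 1 := by
    rw [Real.logb_lt_iff_lt_rpow (by norm_num) hν0]
    have h1 := Nat.lt_pow_succ_log_self (b := 2) (by norm_num) ν
    calc (ν : ℝ) < ((2 ^ (Lg + 1) : ℕ) : ℝ) := by exact_mod_cast h1
      _ = (2 : ℝ) ^ ((Lg : ℝ) + 1) := by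
          rw [← Nat.cast_add_one, Real.rpow_natCast]; push_cast; ring
  have hlogb0 : 0 ≤ Real.logb 2 ν :=
    Real.logb_nonneg (by norm_num) (by exact_mod_cast (show 1 ≤ ν by omega))
  have hm10 : (Lg : ℝ) + 1 ≤ 10 * (m : ℝ) := by
    have : Lg + 1 ≤ 10 * m := by omega
    exact_mod_cast this
  have hexp : 1 / 100 * Real.logb 2 ν ^ 2 ≤ ((m ^ 2 : ℕ) : ℝ) := by
    push_cast
    have h1 : Real.logb 2 ν ≤ 10 * m := by linarith
    have h2 : Real.logb 2 ν ^ 2 ≤ (10 * (m : ℝ)) ^ 2 := pow_le_pow_left₀ hlogb0 h1 2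
    nlinarith
  calc (2 : ℝ) ^ (1 / 100 * Real.logb 2 ν ^ 2) ≤ (2 : ℝ) ^ ((m ^ 2 : ℕ) : ℝ) :=
        Real.rpow_le_rpow_of_exponent_le (by norm_num) hexp
    _ = (((2 ^ m) ^ m : ℕ) : ℝ) := by
        rw [Real.rpow_natCast, ← pow_mul, sq]; push_cast; ring
    _ ≤ _ := hcount


end Literature.Computability.AlgebraicComplexity
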